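import Literature.AlgebraicGeometry.HodgeTheory.MaximalPicardNumberHodgeClasses
import Literature.AlgebraicGeometry.HodgeTheory.RationalClassesIndependent
import Literature.AlgebraicGeometry.HodgeTheory.AbelianVarietyEndomorphismsHOne
import Mathlib.LinearAlgebra.Trace
import Mathlib.LinearAlgebra.Projection
import Mathlib.Tactic.Module
import HarnessLib

/-!
# `Bᵖ ⊆ Dᵖ ⊗ ℂ` and the Hodge conjecture for products of copies of finitely many elliptic curves with complex multiplication by PAIRWISE DIFFERENT imaginary quadratic fields (Tate, Imai)

Family `hodge`, layer `Literature/AlgebraicGeometry/HodgeTheory`. Research context of the cell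
`pub-hodge-ring2`: a route conditional on HC_CM; this file is UNCONDITIONAL Hodge theory of products
of CM elliptic curves and is not a step towards a summit statement (it enlarges the stock of abelian
varieties at which "HC_CM" is a theorem of the tree rather than a hypothesis). PUBLISHED STATEMENT
(van Geemen LNM 1594 Thm. 4.3 after Tate; Imai / Moonen–Zarhin 1999 Cor. (3.9)), NEW FORMAL PROOF.

FILE HISTORY: first landed for TWO curves (p194131, label type `Bool`, predicate `TwoCMSlots`);
generalised IN PLACE to finitely many curves (label type `L`, predicate `CMSlots`; the two-curve API of
§§5–6 — `TwoCMSlots`, `hodgeConjectureFor_of_isIsogenous_twoCMCurves`, … — is kept with unchanged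
statements and derived from the general one; the module keeps its historical name). For finitely many
complex elliptic curves `E_l` (`l ∈ L`) with `ψ_l ≫ ψ_l = -d_l`, `d_l ≥ 1`, and `d_l d_{l'}` NOT a
square for `l ≠ l'` (complex multiplication by pairwise different fields `ℚ(√-d_l)`),

  `Bᵖ(B) ⊆ Dᵖ(B) ⊗ ℂ` for every `p` and every product `B` of copies of the `E_l`

("For an abelian variety `X` which is isogeneous to a product of elliptic curves … `Bᵖ(X) = Dᵖ(X)`
for all `p`", van Geemen Thm. 4.3 (Tate); Imai: the Hodge group of a product of pairwise
non-isogenous elliptic curves is the product of the Hodge groups, Moonen–Zarhin 1999 Cor. (3.9)),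
hence the Hodge conjecture for `B` (Lefschetz `(1,1)` + products of divisors are algebraic) and for
every complex abelian variety isogenous to such a `B` (van Geemen Lemma 3.7, the tree's
`HodgeConjectureFor.of_isIsogenous`).

## The mechanism (carriers `Hᵏ(B(ℂ); ℂ)`; no Hodge group, no Galois group)

§§1–3 repeat the engine of the two-curve file with an arbitrary finite label type `L` in place of
`Bool` (slots `j` with labels `ℓ j ∈ L`, slot projections `g_j`, slot endomorphisms `T_j`; cup
monomials `m_φ` in the coloured generators `x_j`, `x̄_j`; the RATIONAL key projectors — `ℚ`-polynomials
in `T_j^{*2}` and `T_j^* T_{j'}^*` (`ℓ j = ℓ j'`) — cutting `H²ᵖ` into key classes; balanced keys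
⊆ `Dᵖ ⊗ ℂ` by the cross classes `x_j ⌣ x̄_{j'}` of `E_l × E_l`). The one NEW step is the vanishing of
the rational `(p,p)`-classes of an UNBALANCED key, where the two-curve argument ("flipping both labels
or none: ONE irrational eigenvalue `±μ₁μ₂`") fails from four labels on (with one single slot in each
of four labels and flip pattern `(+,+,−,−)` every pair operator has both eigenvalues `±√(d_i d_j)` on
the `(2,2)`-part). It is replaced by a TRACE ARGUMENT (§0′, `CMSlots.eq_zero_of_unbalanced`):
* the span `U` of the rational classes inside the span `V` of the `(p,p)`-monomials of the key is
  stable under the slot operators, and the trace of any `ℚ`-polynomial in pull-backs restricted to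
  `U` is RATIONAL (its matrix in a rational basis is rational: a complex relation among rational
  classes is a rational one, `linearIndependent_iff_of_isRationalClass`);
* for single slots `j₀`, `j` of DIFFERENT labels, `C_j = T_{j₀}^* T_j^*` has `C_j² = d_{ℓ j₀} d_{ℓ j}`
  on `V`, so `tr(C_j|_U) ∈ √(d_{ℓ j₀} d_{ℓ j}) · ℤ`, hence `tr(C_j|_U) = 0` (`d_{ℓ j₀} d_{ℓ j}` is not
  a square); for the SAME label, `C_j` is a constant `± d_{ℓ j₀}` on the key;
* the `(p,p)` constraint says that the numbers of `x`- and `x̄`-coloured single slots agree, i.e. the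
  operator `N = ∑_{j single} μ_{ℓ j}⁻¹ T_{j₀}^* T_j^*` VANISHES on `V`; taking the trace of `N|_U`
  leaves `± μ_{ℓ j₀} · dim U · (#x-singles − #x̄-singles of label ℓ j₀) = 0`, and at an unbalanced
  label the last factor is non-zero: `dim U = 0`.
Only PAIRS of labels enter, so "pairwise different CM fields" is exactly the hypothesis needed; this
is the carrier-level shadow of "`Hg(∏ E_l^{m_l}) = ∏_l U(1)` (Imai) and no non-zero weight of an
unbalanced key is trivial" in the printed proofs.

Everything below is proved; one definition (`CMSlots`, the slot structure, a `Prop`-valued predicate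
with a body), one auxiliary definition (`cmListProd`, iterated products) and no named fact is
introduced (D-0026); axioms standard.

HONEST SCOPE: finitely many CM elliptic curves with PAIRWISE DIFFERENT CM fields, any number of
copies of each, any bracketing (`CMSlots.prod`), and the isogeny class of such products. Two complex
elliptic curves with complex multiplication by the same imaginary quadratic field are isogenous, so a
product of powers of ARBITRARY CM elliptic curves is isogenous to a product of the shape treated here
(one label per CM field) — but that isogeny is an input the user must supply (`IsIsogenous`), it is not
constructed in this file. Not covered: non-CM elliptic curves (Imai's theorem in full is a Hodge-group
computation) and the predicate `HodgeClassesProductSpan` of `HodgeGroupProductCMFactor`.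

## References

* [vanGeemen1994HodgeAV] B. van Geemen, An introduction to the Hodge conjecture for abelian
  varieties, LNM 1594 (1994), Thm. 4.3 (Tate), Lemma 3.7, §5.3.
* [MoonenZarhin1999LowDim] B. Moonen, Yu. Zarhin, Hodge classes on abelian varieties of low
  dimension, Math. Ann. 315 (1999) 711–733 (arXiv:math/9901113), §3 (3.1), Cor. (3.9) (Imai).
* [Gordon1997] B. B. Gordon, A survey of the Hodge conjecture for abelian varieties,
  arXiv:alg-geom/9709030 = Appendix B of Lewis, CRM Monogr. Ser. 10 (1999), §3 (Tate, Murasaki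
  [B.80], Imai [B.58], Murty [B.84]).
* [LangeBirkenhake1992] H. Lange, Ch. Birkenhake, Complex Abelian Varieties (1992), §1.1
  Lemma 1.1.17, Thm. 4.2.1, §5.
* [VoisinHodgeI2002] C. Voisin, Hodge Theory and Complex Algebraic Geometry I (2002), §6.1.3,
  §7.1.1, §7.3.2, §11.3.
* [HatcherAT2002] A. Hatcher, Algebraic Topology (2002), §3.1 Thm. 3.2, §3.2 Prop. 3.10.
-/

noncomputable section

open CategoryTheory
open Literature.AlgebraicTopology.SingularHomology
open Literature.AlgebraicGeometry.Motives (IsSmoothProjective AbelianVariety)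
open Literature.Barriers.HodgeConjecture

namespace Literature.AlgebraicGeometry.HodgeTheory

section HodgeTheory

/-! ### §0 Scalars: `μ² = -d`, `μ̄ = -μ`, `μ₁ μ₂ ∉ ℚ`; rational classes with an irrational eigenvalue -/

section Scalars

/-- A complex number with `μ² = -d`, `d > 0` real, is purely imaginary: `μ̄ = -μ` (a private copy of
the tree's `conj_eq_neg_of_sq_eq_neg` of `WeilLineDetOfLevelStructure`, to keep the imports small).
[folklore] -/
private theorem conj_eq_neg_of_sq_eq_neg_aux {μ : ℂ} {d : ℕ} (hd : 0 < d) (hμ : μ ^ 2 = -(d : ℂ)) :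
    starRingEnd ℂ μ = -μ := by
  have hre2 := congrArg Complex.re hμ
  have him2 := congrArg Complex.im hμ
  simp only [pow_two, Complex.mul_re, Complex.mul_im, Complex.neg_re, Complex.neg_im,
    Complex.natCast_re, Complex.natCast_im, neg_zero] at hre2 him2
  have hre : μ.re = 0 := by
    by_contra h
    have him : μ.im = 0 := by
      have h2 : 2 * (μ.re * μ.im) = 0 := by linarith
      rcases mul_eq_zero.1 h2 with h2 | h2
      · norm_num at h2
      · exact (mul_eq_zero.1 h2).resolve_left h
    rw [him, mul_zero, sub_zero] at hre2
    nlinarith [mul_self_nonneg μ.re, (Nat.cast_pos.2 hd : (0 : ℝ) < d)]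
  apply Complex.ext
  · simp [hre]
  · simp

/-- `μ₁² = -d₁`, `μ₂² = -d₂` and `d₁ d₂` not a square: `± μ₁ μ₂` is not a rational number. [folklore] -/
theorem mul_ne_ratCast_of_not_isSquare {μ₁ μ₂ : ℂ} {d₁ d₂ : ℕ} (h₁ : μ₁ ^ 2 = -(d₁ : ℂ))
    (h₂ : μ₂ ^ 2 = -(d₂ : ℂ)) (hsq : ¬ IsSquare (d₁ * d₂)) (s : ℂ) (hs : s = 1 ∨ s = -1) (q : ℚ) :
    s * (μ₁ * μ₂) ≠ (q : ℂ) := by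
  intro h
  have hs2 : s ^ 2 = 1 := by rcases hs with rfl | rfl <;> norm_num
  have hsqC : (((d₁ * d₂ : ℕ) : ℚ) : ℂ) = ((q ^ 2 : ℚ) : ℂ) := by
    push_cast
    rw [← h]
    linear_combination (-(s ^ 2 * μ₂ ^ 2)) * h₁ + (s ^ 2 * (d₁ : ℂ)) * h₂ + (-((d₁ : ℂ) * d₂)) * hs2
  have hsqQ : ((d₁ * d₂ : ℕ) : ℚ) = q ^ 2 := by exact_mod_cast hsqC
  exact hsq (Rat.isSquare_natCast_iff.1 ⟨q, by rw [hsqQ, sq]⟩)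

variable {Y : Type} [TopologicalSpace Y] {k : ℕ}

/-- **A rational class which is an eigenvector of a rationality-preserving operator for an
IRRATIONAL eigenvalue is zero**: if `v` and `R v = ρ v` are both rational classes of `Hᵏ(Y; ℂ)` and
`ρ ∉ ℚ`, then `v = 0` (`Hᵏ(Y; ℚ) ⊗ ℂ → Hᵏ(Y; ℂ)` is injective: a complex relation between rational
classes is a rational one, `linearIndependent_iff_of_isRationalClass`).
[cite: VoisinHodgeI2002, §7.1.1] [cite: HatcherAT2002, §3.1 Thm. 3.2] -/
theorem eq_zero_of_isRationalClass_of_eq_smul {v w : singularCohomology ℂ ℂ Y k}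
    (hv : IsRationalClass v) (hw : IsRationalClass w) {ρ : ℂ} (hρ : ∀ q : ℚ, ρ ≠ (q : ℂ))
    (h : w = ρ • v) : v = 0 := by
  by_contra hne
  have hratfam : ∀ j, IsRationalClass ((![v, w] : Fin 2 → singularCohomology ℂ ℂ Y k) j) := by
    intro j
    fin_cases j
    · exact hv
    · exact hw
  have hdep : ¬ LinearIndependent ℂ ![v, w] := by
    intro hli
    have h' := (LinearIndependent.pair_iff.1 hli) ρ (-1) (by rw [h, neg_one_smul, add_neg_cancel])
    exact one_ne_zero (neg_eq_zero.1 h'.2)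
  rw [linearIndependent_iff_of_isRationalClass hratfam] at hdep
  obtain ⟨q, hq⟩ := not_forall.1 hdep
  obtain ⟨hq1, hq2⟩ := Classical.not_imp.1 hq
  rw [Fin.sum_univ_two] at hq1
  change ((q 0 : ℚ) : ℂ) • v + ((q 1 : ℚ) : ℂ) • w = 0 at hq1
  rw [h, smul_smul, ← add_smul] at hq1
  have hcoef : ((q 0 : ℚ) : ℂ) + ((q 1 : ℚ) : ℂ) * ρ = 0 := (smul_eq_zero.1 hq1).resolve_right hne
  have hq1ne : q 1 ≠ 0 := by
    intro h0
    apply hq2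
    funext j
    fin_cases j
    · have : ((q 0 : ℚ) : ℂ) = 0 := by simpa [h0] using hcoef
      exact_mod_cast this
    · exact h0
  have hq1neC : ((q 1 : ℚ) : ℂ) ≠ 0 := by exact_mod_cast hq1ne
  apply hρ (-(q 0 / q 1))
  push_cast
  field_simp
  linear_combination hcoef

end Scalars

/-! ### §1 The slot structure of a product of copies of finitely many elliptic curves -/

section Slots

variable {L : Type} (E : L → AbelianVariety ℂ) (ψ : ∀ b, E b ⟶ E b) (ω : ∀ b, complexBetti (E b).X 1)

/-- **Slot structure** of a complex abelian variety `B` with respect to elliptic curves `E_l`,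
`l ∈ L`, with endomorphisms `ψ_l` and `(1,0)`-generators `ω_l`: finitely many SLOTS `j` with labels
`ℓ j`, slot projections `g_j : B → E_{ℓ j}` and slot endomorphisms `T_j : B → B` acting as `ψ_{ℓ j}`
on slot `j` and as the identity on the other slots (`T_j ≫ g_j = g_j ≫ ψ`, `T_j ≫ g_i = g_i` for
`i ≠ j`), such that the `(1,0)`-classes of `B` are combinations of the `g_j^* ω_{ℓ j}`. Products of
copies of the `E_l` in any bracketing carry such a structure (`cmSlots_self`,
`CMSlots.prod`): slots = factors, `g_j` = projections, `T_j` = `ψ` on one factor. This is the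
bookkeeping device of Murasaki's / Imai's computations ("explicit differential forms that give a basis
for `Hdg¹(Eⁿ)`", Gordon §3) on the tree's carriers. [cite: Gordon1997, §3]
[cite: LangeBirkenhake1992, Thm. 4.2.1] -/
def CMSlots (B : AbelianVariety ℂ) : Prop :=
  ∃ (J : Type) (_ : Fintype J) (ℓ : J → L) (g : ∀ j : J, B ⟶ E (ℓ j)) (T : J → (B ⟶ B)),
    (∀ j, T j ≫ g j = g j ≫ ψ (ℓ j)) ∧
    (∀ j i, i ≠ j → T j ≫ g i = g i) ∧
    (∀ u : complexBetti B.X 1, IsOfHodgeType B.dim B.X 1 1 0 u →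
      u ∈ Submodule.span ℂ (Set.range fun j ↦ complexBetti.map (g j).hom.hom.hom 1 (ω (ℓ j))))

variable {E ψ ω}

/-- **The curve `E_l` itself has a slot structure** (one slot, `g = 𝟙`, `T = ψ_l`), provided
`H^{1,0}(E_l) = ℂ ω_l` (the case `n = 1` of Murasaki's basis of `H^{1,0}(Eⁿ)` by the `dz_i`, Gordon §3).
[cite: Gordon1997, §3] [cite: LangeBirkenhake1992, Thm. 4.2.1] -/
theorem cmSlots_self (b : L)
    (hω : ∀ u : complexBetti (E b).X 1, IsOfHodgeType (E b).dim (E b).X 1 1 0 u → ∃ c : ℂ, u = c • ω b) :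
    CMSlots E ψ ω (E b) := by
  refine ⟨Unit, inferInstance, fun _ ↦ b, fun _ ↦ 𝟙 (E b), fun _ ↦ ψ b, fun _ ↦ by simp,
    fun j i h ↦ absurd (Subsingleton.elim i j) h, fun u hu ↦ ?_⟩
  obtain ⟨c, rfl⟩ := hω u hu
  refine Submodule.smul_mem _ c (Submodule.subset_span ⟨(), ?_⟩)
  change complexBetti.map (𝟙 (E b).X) 1 (ω b) = ω b
  rw [complexBetti.map_id]
  rfl

/-- **Slot structures multiply**: if `B₁` and `B₂` carry slot structures then so does `B₁ × B₂`
(slots `J₁ ⊕ J₂`; projections `prᵢ ≫ g_j`; slot endomorphisms `(fst ≫ T_j, snd)` and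
`(fst, snd ≫ T_j)` via `prodLift`; `H^{1,0}(B₁ × B₂) = pr₁^*H^{1,0}(B₁) ⊕ pr₂^*H^{1,0}(B₂)`,
`AbelianVariety.exists_eq_of_hodgeOneZero_prod`). [cite: LangeBirkenhake1992, Thm. 4.2.1]
[cite: VoisinHodgeI2002, §7.3.2 and §11.3.3] -/
theorem CMSlots.prod {B₁ B₂ : AbelianVariety ℂ} (h₁ : CMSlots E ψ ω B₁) (h₂ : CMSlots E ψ ω B₂) :
    CMSlots E ψ ω (B₁.prod B₂) := by
  classical
  obtain ⟨J₁, _, ℓ₁, g₁, T₁, hTg₁, hTg₁', hsp₁⟩ := h₁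
  obtain ⟨J₂, _, ℓ₂, g₂, T₂, hTg₂, hTg₂', hsp₂⟩ := h₂
  let p₁ := Motives.AbelianVariety.fst B₁ B₂
  let p₂ := Motives.AbelianVariety.snd B₁ B₂
  refine ⟨J₁ ⊕ J₂, inferInstance, Sum.elim ℓ₁ ℓ₂,
    fun j ↦ match j with
      | Sum.inl j => p₁ ≫ g₁ j
      | Sum.inr j => p₂ ≫ g₂ j,
    fun j ↦ match j with
      | Sum.inl j => Motives.AbelianVariety.prodLift (p₁ ≫ T₁ j) p₂
      | Sum.inr j => Motives.AbelianVariety.prodLift p₁ (p₂ ≫ T₂ j),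
    ?_, ?_, ?_⟩
  · rintro (j | j)
    · change Motives.AbelianVariety.prodLift (p₁ ≫ T₁ j) p₂ ≫ (p₁ ≫ g₁ j) = (p₁ ≫ g₁ j) ≫ ψ (ℓ₁ j)
      rw [← Category.assoc, Motives.AbelianVariety.prodLift_fst, Category.assoc, hTg₁, Category.assoc]
    · change Motives.AbelianVariety.prodLift p₁ (p₂ ≫ T₂ j) ≫ (p₂ ≫ g₂ j) = (p₂ ≫ g₂ j) ≫ ψ (ℓ₂ j)
      rw [← Category.assoc, Motives.AbelianVariety.prodLift_snd, Category.assoc, hTg₂, Category.assoc]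
  · rintro (j | j) (i | i) hij
    · change Motives.AbelianVariety.prodLift (p₁ ≫ T₁ j) p₂ ≫ (p₁ ≫ g₁ i) = p₁ ≫ g₁ i
      rw [← Category.assoc, Motives.AbelianVariety.prodLift_fst, Category.assoc,
        hTg₁' j i fun h ↦ hij (by rw [h])]
    · change Motives.AbelianVariety.prodLift (p₁ ≫ T₁ j) p₂ ≫ (p₂ ≫ g₂ i) = p₂ ≫ g₂ i
      rw [← Category.assoc, Motives.AbelianVariety.prodLift_snd]
    · change Motives.AbelianVariety.prodLift p₁ (p₂ ≫ T₂ j) ≫ (p₁ ≫ g₁ i) = p₁ ≫ g₁ i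
      rw [← Category.assoc, Motives.AbelianVariety.prodLift_fst]
    · change Motives.AbelianVariety.prodLift p₁ (p₂ ≫ T₂ j) ≫ (p₂ ≫ g₂ i) = p₂ ≫ g₂ i
      rw [← Category.assoc, Motives.AbelianVariety.prodLift_snd, Category.assoc,
        hTg₂' j i fun h ↦ hij (by rw [h])]
  · intro u hu
    obtain ⟨a, b, ha, hb, rfl⟩ := AbelianVariety.exists_eq_of_hodgeOneZero_prod B₁ B₂ u hu
    set S := Submodule.span ℂ (Set.range fun j : J₁ ⊕ J₂ ↦ complexBetti.map
      ((match j with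
        | Sum.inl j => p₁ ≫ g₁ j
        | Sum.inr j => p₂ ≫ g₂ j) : B₁.prod B₂ ⟶ E (Sum.elim ℓ₁ ℓ₂ j)).hom.hom.hom 1
          (ω (Sum.elim ℓ₁ ℓ₂ j))) with hS
    have hle₁ : Submodule.span ℂ (Set.range fun j ↦ complexBetti.map (g₁ j).hom.hom.hom 1 (ω (ℓ₁ j))) ≤
        S.comap (complexBetti.map p₁.hom.hom.hom 1).hom := by
      refine Submodule.span_le.2 ?_
      rintro _ ⟨j, rfl⟩
      refine Submodule.subset_span ⟨Sum.inl j, ?_⟩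
      change complexBetti.map (p₁ ≫ g₁ j).hom.hom.hom 1 (ω (ℓ₁ j)) = complexBetti.map p₁.hom.hom.hom 1 _
      rw [complexBetti_map_map_hom]
    have hle₂ : Submodule.span ℂ (Set.range fun j ↦ complexBetti.map (g₂ j).hom.hom.hom 1 (ω (ℓ₂ j))) ≤
        S.comap (complexBetti.map p₂.hom.hom.hom 1).hom := by
      refine Submodule.span_le.2 ?_
      rintro _ ⟨j, rfl⟩
      refine Submodule.subset_span ⟨Sum.inr j, ?_⟩
      change complexBetti.map (p₂ ≫ g₂ j).hom.hom.hom 1 (ω (ℓ₂ j)) = complexBetti.map p₂.hom.hom.hom 1 _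
      rw [complexBetti_map_map_hom]
    exact Submodule.add_mem _ (hle₁ (hsp₁ a ha)) (hle₂ (hsp₂ b hb))

/-- Slot structure of the powers `B.powSucc N = (⋯(B × B) × ⋯) × B` (Künneth in degree one, iterated). [cite: LangeBirkenhake1992, Thm. 4.2.1] -/
theorem CMSlots.powSucc {B : AbelianVariety ℂ} (h : CMSlots E ψ ω B) :
    ∀ N : ℕ, CMSlots E ψ ω (B.powSucc N)
  | 0 => h
  | N + 1 => (CMSlots.powSucc h N).prod h

end Slots

/-! ### §2 A multilinear expansion lemma (after §0′) -/

namespace CMSlots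

/-! ### §0′ Linear algebra on sub-carriers: rational coordinates, rational traces, involution traces

The carrier-level shadow of Galois theory used for unbalanced keys: a `ℚ`-polynomial in pull-backs
restricted to a subspace spanned by rational classes has a RATIONAL trace (its matrix in a rational
basis is rational — a complex relation among rational classes is a rational one,
`linearIndependent_iff_of_isRationalClass`), while an operator of square `D` has trace in `√D · ℤ`. -/

section LinearAlgebra

variable {Y : Type} [TopologicalSpace Y] {k : ℕ}

/-- **Rational coordinates**: a rational class lying in the `ℂ`-span of a `ℂ`-linearly independent
finite family of rational classes has RATIONAL coordinates in that family (`Hᵏ(Y; ℚ) ⊗ ℂ ↪ Hᵏ(Y; ℂ)`).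
[cite: VoisinHodgeI2002, §7.1.1] [cite: HatcherAT2002, §3.1 Thm. 3.2] -/
private theorem exists_rat_coords_of_isRationalClass {ι : Type} [Fintype ι]
    {u : ι → singularCohomology ℂ ℂ Y k} (hu : ∀ i, IsRationalClass (u i))
    (hli : LinearIndependent ℂ u) {w : singularCohomology ℂ ℂ Y k} (hw : IsRationalClass w)
    (hmem : w ∈ Submodule.span ℂ (Set.range u)) :
    ∃ q : ι → ℚ, w = ∑ i, ((q i : ℚ) : ℂ) • u i := by
  classical
  -- the extended family `none ↦ w, some i ↦ u i` is `ℂ`-dependent, hence `ℚ`-dependent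
  set u' : Option ι → singularCohomology ℂ ℂ Y k := fun o ↦ Option.casesOn' o w u with hu'
  have hu'rat : ∀ o, IsRationalClass (u' o) := by
    rintro (_ | i)
    · exact hw
    · exact hu i
  have hdep : ¬ LinearIndependent ℂ u' := fun h ↦ (linearIndependent_option.1 h).2 hmem
  rw [linearIndependent_iff_of_isRationalClass hu'rat] at hdep
  push Not at hdep
  obtain ⟨q', hq', hq'ne⟩ := hdep
  rw [Fintype.sum_option] at hq'
  change ((q' none : ℚ) : ℂ) • w + ∑ i, ((q' (some i) : ℚ) : ℂ) • u i = 0 at hq'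
  have h0 : q' none ≠ 0 := by
    intro h0
    rw [h0, Rat.cast_zero, zero_smul, zero_add] at hq'
    have hsome : (fun i ↦ q' (some i)) = 0 :=
      (linearIndependent_iff_of_isRationalClass hu).1 hli (fun i ↦ q' (some i)) hq'
    apply hq'ne
    funext o
    rcases o with _ | i
    · exact h0
    · exact congrFun hsome i
  refine ⟨fun i ↦ -(q' (some i) / q' none), ?_⟩
  have h0C : ((q' none : ℚ) : ℂ) ≠ 0 := by exact_mod_cast h0
  have hw' : w = -(((q' none : ℚ) : ℂ)⁻¹ • ∑ i, ((q' (some i) : ℚ) : ℂ) • u i) := by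
    rw [eq_neg_iff_add_eq_zero, ← smul_right_injective _ h0C |>.eq_iff, smul_add, smul_inv_smul₀ h0C,
      smul_zero]
    · exact hq'
  rw [hw', Finset.smul_sum, ← Finset.sum_neg_distrib]
  refine Finset.sum_congr rfl fun i _ ↦ ?_
  rw [smul_smul, ← neg_smul]
  congr 1
  push_cast
  ring

/-- **Rational trace.** Let `U` be a finite-dimensional subspace of `Hᵏ(Y; ℂ)` spanned by rational
classes and `F` an endomorphism of `Hᵏ(Y; ℂ)` mapping rational classes to rational classes and `U`
into itself. Then the trace of `F|_U` is a rational number (its matrix in a rational basis of `U` is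
rational). [cite: VoisinHodgeI2002, §7.1.1] [cite: HatcherAT2002, §3.1 Thm. 3.2] -/
private theorem exists_rat_trace_restrict {U : Submodule ℂ (singularCohomology ℂ ℂ Y k)}
    [FiniteDimensional ℂ U]
    (hU : Submodule.span ℂ {u : U | IsRationalClass (u : singularCohomology ℂ ℂ Y k)} = ⊤)
    {F : Module.End ℂ (singularCohomology ℂ ℂ Y k)}
    (hFrat : ∀ v, IsRationalClass v → IsRationalClass (F v)) (hF : ∀ x ∈ U, F x ∈ U) :
    ∃ q : ℚ, LinearMap.trace ℂ U (F.restrict hF) = (q : ℂ) := by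
  classical
  obtain ⟨b, hb_sub, hb_span, hb_li⟩ :=
    exists_linearIndependent ℂ {u : U | IsRationalClass (u : singularCohomology ℂ ℂ Y k)}
  have hfin : b.Finite := hb_li.setFinite
  haveI : Fintype b := hfin.fintype
  have hb_top : ⊤ ≤ Submodule.span ℂ (Set.range ((↑) : b → U)) := by
    rw [Subtype.range_coe, hb_span, hU]
  let B : Module.Basis b ℂ U := Module.Basis.mk hb_li hb_top
  have hBapply : ∀ i : b, B i = (i : U) := fun i ↦ Module.Basis.mk_apply hb_li hb_top i
  -- the vectors of `B`, seen in `Hᵏ(Y; ℂ)`, are rational and `ℂ`-linearly independent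
  have hrat : ∀ i : b, IsRationalClass ((B i : U) : singularCohomology ℂ ℂ Y k) := by
    intro i; rw [hBapply]; exact hb_sub i.2
  have hliM : LinearIndependent ℂ (fun i : b ↦ ((B i : U) : singularCohomology ℂ ℂ Y k)) := by
    have h := B.linearIndependent.map' U.subtype (Submodule.ker_subtype U)
    exact h
  -- every matrix entry of `F|_U` in the basis `B` is rational
  have hentry : ∀ j : b, ∃ q : b → ℚ, ∀ i, LinearMap.toMatrix B B (F.restrict hF) i j = (q i : ℂ) := by
    intro j
    have hmem : ((F.restrict hF (B j) : U) : singularCohomology ℂ ℂ Y k) ∈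
        Submodule.span ℂ (Set.range fun i : b ↦ ((B i : U) : singularCohomology ℂ ℂ Y k)) := by
      have h1 : F.restrict hF (B j) ∈ Submodule.span ℂ (Set.range B) := by
        rw [B.span_eq]; exact Submodule.mem_top
      have h2 := Submodule.apply_mem_span_image_of_mem_span U.subtype h1
      rwa [← Set.range_comp] at h2
    have hwrat : IsRationalClass ((F.restrict hF (B j) : U) : singularCohomology ℂ ℂ Y k) := by
      rw [LinearMap.restrict_apply]; exact hFrat _ (hrat j)
    obtain ⟨q, hq⟩ := exists_rat_coords_of_isRationalClass hrat hliM hwrat hmem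
    refine ⟨q, fun i ↦ ?_⟩
    have hU' : F.restrict hF (B j) = ∑ i, ((q i : ℚ) : ℂ) • B i := by
      apply Subtype.ext
      rw [hq]
      simp
    rw [LinearMap.toMatrix_apply, hU', map_sum]
    simp [Finsupp.single_apply, B.repr_self]
  choose q hq using hentry
  refine ⟨∑ i, q i i, ?_⟩
  rw [LinearMap.trace_eq_matrix_trace ℂ B, Matrix.trace]
  push_cast
  exact Finset.sum_congr rfl fun i _ ↦ by rw [Matrix.diag_apply, hq i i]

/-- **Trace of an operator of square `D = s²`**: if `f ∘ f = D · id` on a finite-dimensional complex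
vector space and `s ≠ 0`, then `tr f ∈ s · ℤ` (`(id + s⁻¹ f)/2` is the projector onto the
`s`-eigenspace, of trace its rank). [folklore] -/
private theorem exists_int_trace_of_mul_self_eq {V : Type} [AddCommGroup V] [Module ℂ V] [FiniteDimensional ℂ V]
    (f : Module.End ℂ V) {D s : ℂ} (hs : s ^ 2 = D) (hs0 : s ≠ 0) (hf : f * f = D • 1) :
    ∃ m : ℤ, LinearMap.trace ℂ V f = m * s := by
  set P : Module.End ℂ V := (2 : ℂ)⁻¹ • (1 + s⁻¹ • f) with hP
  have hPP : IsIdempotentElem P := by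
    change P * P = P
    have hsD : s⁻¹ * s⁻¹ * D = 1 := by rw [← hs]; field_simp
    have h2 : (1 + s⁻¹ • f) * (1 + s⁻¹ • f) = (2 : ℂ) • (1 + s⁻¹ • f) := by
      calc (1 + s⁻¹ • f) * (1 + s⁻¹ • f)
          = 1 + s⁻¹ • f + s⁻¹ • f + (s⁻¹ * s⁻¹) • (f * f) := by
            rw [mul_add, add_mul, add_mul, one_mul, mul_one, one_mul, smul_mul_smul_comm]; abel
        _ = 1 + s⁻¹ • f + s⁻¹ • f + 1 := by rw [hf, smul_smul, hsD, one_smul]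
        _ = (2 : ℂ) • (1 + s⁻¹ • f) := by rw [two_smul]; abel
    rw [hP, smul_mul_smul_comm, h2, smul_smul]
    norm_num
  obtain ⟨W, hW⟩ := (LinearMap.isProj_iff_isIdempotentElem P).2 hPP
  have htrP : LinearMap.trace ℂ V P = (Module.finrank ℂ W : ℂ) := hW.trace
  have hfP : f = s • ((2 : ℂ) • P - 1) := by
    rw [hP, smul_smul, mul_inv_cancel₀ (two_ne_zero' ℂ), one_smul, add_sub_cancel_left, smul_smul,
      mul_inv_cancel₀ hs0, one_smul]
  refine ⟨2 * (Module.finrank ℂ W : ℤ) - (Module.finrank ℂ V : ℤ), ?_⟩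
  rw [hfP, map_smul, map_sub, map_smul, htrP, Module.End.one_eq_id, LinearMap.trace_id, smul_eq_mul]
  push_cast
  ring

end LinearAlgebra

section Multilinear

/-- **Expansion of a multilinear map on a finite spanning family**: if every argument `v i` lies in
the span of a finite family `gen`, then `f v` lies in the span of the values `f (gen ∘ φ)` over all
choice functions `φ` (expand each argument and use multilinearity, `MultilinearMap.map_sum`,
`MultilinearMap.map_smul_univ`). [folklore] -/
private theorem MultilinearMap.mem_span_range_comp_of_mem_span {ι : Type*} [Fintype ι] [DecidableEq ι]
    {M N : Type*} [AddCommGroup M] [Module ℂ M] [AddCommGroup N] [Module ℂ N]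
    (f : MultilinearMap ℂ (fun _ : ι ↦ M) N) {G : Type*} [Fintype G] (gen : G → M) (v : ι → M)
    (hv : ∀ i, v i ∈ Submodule.span ℂ (Set.range gen)) :
    f v ∈ Submodule.span ℂ (Set.range fun φ : ι → G ↦ f (gen ∘ φ)) := by
  choose coef hcoef using fun i ↦ (Submodule.mem_span_range_iff_exists_fun ℂ).1 (hv i)
  have hv' : v = fun i ↦ ∑ x : G, coef i x • gen x := funext fun i ↦ (hcoef i).symm
  rw [hv', MultilinearMap.map_sum f (fun i x ↦ coef i x • gen x)]
  refine Submodule.sum_mem _ fun φ _ ↦ ?_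
  rw [MultilinearMap.map_smul_univ]
  exact Submodule.smul_mem _ _ (Submodule.subset_span ⟨φ, rfl⟩)

end Multilinear

/-! ### §3 The engine: monomials, slot operators, keys -/

section Engine

variable {L : Type} [DecidableEq L] {E : L → AbelianVariety ℂ} {ψ : ∀ b, E b ⟶ E b}
  {ω : ∀ b, complexBetti (E b).X 1}
  {μ : L → ℂ} {B : AbelianVariety ℂ} {J : Type} [Fintype J] [DecidableEq J] {ℓ : J → L}
  {g : ∀ j : J, B ⟶ E (ℓ j)} {T : J → (B ⟶ B)}

/-- The slot generator `x_j = g_j^* ω_{ℓ j} ∈ H¹(B(ℂ); ℂ)`. [folklore] -/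
private def slotGen (ω : ∀ b, complexBetti (E b).X 1) (g : ∀ j : J, B ⟶ E (ℓ j)) (j : J) : complexBetti B.X 1 :=
  complexBetti.map (g j).hom.hom.hom 1 (ω (ℓ j))

/-- The coloured generators `z_{(j, tt)} = x_j`, `z_{(j, ff)} = x̄_j` of `H¹(B(ℂ); ℂ)`. [folklore] -/
private def colGen (ω : ∀ b, complexBetti (E b).X 1) (g : ∀ j : J, B ⟶ E (ℓ j)) (a : J × Bool) :
    complexBetti B.X 1 :=
  if a.2 then slotGen ω g a.1 else conjClass (Motives.ComplexPoints B.X) 1 (slotGen ω g a.1)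

/-- The cup monomial `m_φ = z_{φ 0} ⌣ ⋯ ⌣ z_{φ (n-1)} ∈ Hⁿ(B(ℂ); ℂ)` of a word `φ` in the coloured
generators. [cite: LangeBirkenhake1992, Lemma 1.1.17] -/
private def mono (ω : ∀ b, complexBetti (E b).X 1) (g : ∀ j : J, B ⟶ E (ℓ j)) (n : ℕ) (φ : Fin n → J × Bool) :
    complexBetti B.X n :=
  cupPowOne ℂ (Motives.ComplexPoints B.X) n (colGen ω g ∘ φ)

/-- The eigenvalue of the slot operator `T_j^*` on the coloured generator `z_a`: `μ_{ℓ j}` on `x_j`,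
`-μ_{ℓ j} = μ̄_{ℓ j}` on `x̄_j`, `1` on the generators of the other slots. [folklore] -/
private def slotEv (μ : L → ℂ) (ℓ : J → L) (j : J) (a : J × Bool) : ℂ :=
  if a.1 = j then (if a.2 then μ (ℓ j) else -μ (ℓ j)) else 1

/-- The slot operator `T_j^*` on `Hⁿ(B(ℂ); ℂ)` as a linear endomorphism. [folklore] -/
private def slotOp (T : J → (B ⟶ B)) (j : J) (n : ℕ) : Module.End ℂ (complexBetti B.X n) :=
  (complexBetti.map (T j).hom.hom.hom n).hom

omit [Fintype J] [DecidableEq J] [DecidableEq L] in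
/-- `x_j` is of type `(1,0)`. [cite: VoisinHodgeI2002, §7.3.2] -/
private theorem isOfHodgeType_slotGen (hω : ∀ b, IsOfHodgeType (E b).dim (E b).X 1 1 0 (ω b)) (j : J) :
    IsOfHodgeType B.dim B.X 1 1 0 (slotGen ω g j) :=
  (hω (ℓ j)).map_of_isSmoothProjective Motives.AbelianVariety.isSmoothProjective_holds
    Motives.AbelianVariety.isSmoothProjective_holds (g j).hom.hom.hom

omit [Fintype J] [DecidableEq J] [DecidableEq L] in
/-- `z_{(j,c)}` is of type `(1,0)` if `c = tt` and `(0,1)` if `c = ff`. [cite: VoisinHodgeI2002, §7.3.2] -/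
private theorem isOfHodgeType_colGen (hω : ∀ b, IsOfHodgeType (E b).dim (E b).X 1 1 0 (ω b)) (a : J × Bool) :
    IsOfHodgeType B.dim B.X 1 (if a.2 then 1 else 0) (if a.2 then 0 else 1) (colGen ω g a) := by
  obtain ⟨j, c⟩ := a
  cases c
  · simpa [colGen] using (isOfHodgeType_slotGen hω j).conjClass
      (Motives.AbelianVariety.isSmoothProjective_holds (A := B))
  · simpa [colGen] using isOfHodgeType_slotGen (g := g) hω j

omit [Fintype J] [DecidableEq L] in
/-- **`T_j^* x_i = x_i` (`i ≠ j`), `T_j^* x_j = μ x_j`** (`T_j ≫ g_i = g_i`, `T_j ≫ g_j = g_j ≫ ψ`,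
`ψ^* ω = μ ω`). [folklore] -/
private theorem slotOp_slotGen (hμω : ∀ b, complexBetti.map (ψ b).hom.hom.hom 1 (ω b) = μ b • ω b)
    (hTg : ∀ j, T j ≫ g j = g j ≫ ψ (ℓ j)) (hTg' : ∀ j i, i ≠ j → T j ≫ g i = g i) (j i : J) :
    complexBetti.map (T j).hom.hom.hom 1 (slotGen ω g i) =
      (if i = j then μ (ℓ i) else 1) • slotGen ω g i := by
  unfold slotGen
  rw [complexBetti_map_map_hom]
  by_cases hij : i = j
  · subst hij
    rw [if_pos rfl, hTg i, ← complexBetti_map_map_hom, hμω, map_smul]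
  · rw [if_neg hij, hTg' j i hij, one_smul]

omit [Fintype J] [DecidableEq L] in
/-- **`T_j^* z_a = ev_j(a) z_a`** on the coloured generators (`x̄_j = conj x_j`, `conj μ = -μ`). [folklore] -/
private theorem slotOp_colGen (hμω : ∀ b, complexBetti.map (ψ b).hom.hom.hom 1 (ω b) = μ b • ω b)
    (hμc : ∀ b, starRingEnd ℂ (μ b) = -μ b)
    (hTg : ∀ j, T j ≫ g j = g j ≫ ψ (ℓ j)) (hTg' : ∀ j i, i ≠ j → T j ≫ g i = g i) (j : J) (a : J × Bool) :
    complexBetti.map (T j).hom.hom.hom 1 (colGen ω g a) = slotEv μ ℓ j a • colGen ω g a := by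
  obtain ⟨i, c⟩ := a
  cases c
  · simp only [colGen, slotEv, Bool.false_eq_true, ↓reduceIte]
    change complexBetti.map (T j).hom.hom.hom 1 (conjClass _ 1 (slotGen ω g i)) = _
    rw [← conjClass_map, slotOp_slotGen hμω hTg hTg' j i, conjClass_smul]
    by_cases hij : i = j
    · subst hij; simp [hμc]
    · simp [hij]
  · simp only [colGen, slotEv, ↓reduceIte]
    rw [slotOp_slotGen hμω hTg hTg' j i]
    by_cases hij : i = j
    · subst hij; simp
    · simp [hij]

omit [Fintype J] [DecidableEq L] in
/-- **`T_j^*` is diagonal on the monomials**: `T_j^* m_φ = (∏ᵢ ev_j(φ i)) m_φ` (pull-back is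
multiplicative, `complexBetti_map_cupPowOne`). [cite: HatcherAT2002, §3.2 Prop. 3.10] -/
private theorem slotOp_mono (hμω : ∀ b, complexBetti.map (ψ b).hom.hom.hom 1 (ω b) = μ b • ω b)
    (hμc : ∀ b, starRingEnd ℂ (μ b) = -μ b)
    (hTg : ∀ j, T j ≫ g j = g j ≫ ψ (ℓ j)) (hTg' : ∀ j i, i ≠ j → T j ≫ g i = g i) (j : J) {n : ℕ}
    (φ : Fin n → J × Bool) :
    slotOp T j n (mono ω g n φ) = (∏ i, slotEv μ ℓ j (φ i)) • mono ω g n φ := by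
  unfold slotOp mono
  change complexBetti.map (T j).hom.hom.hom n (cupPowOne ℂ _ n (colGen ω g ∘ φ)) = _
  rw [Motives.complexBetti_map_cupPowOne]
  have h : (fun i ↦ complexBetti.map (T j).hom.hom.hom 1 ((colGen ω g ∘ φ) i)) =
      fun i ↦ slotEv μ ℓ j (φ i) • (colGen ω g ∘ φ) i :=
    funext fun i ↦ slotOp_colGen hμω hμc hTg hTg' j (φ i)
  rw [h, MultilinearMap.map_smul_univ]

omit [Fintype J] [DecidableEq J] [DecidableEq L] in
/-- **`H¹(B) = span {x_j, x̄_j}`**: every degree-one class is a combination of the coloured generators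
(`H¹ = H^{1,0} ⊕ H^{0,1}`, `H^{1,0} = span {x_j}` by the slot structure, `H^{0,1} = conj H^{1,0}`).
[cite: VoisinHodgeI2002, §6.1.3 Cor. 6.12 and §7.1.1] -/
private theorem mem_span_colGen
    (hspan : ∀ u : complexBetti B.X 1, IsOfHodgeType B.dim B.X 1 1 0 u →
      u ∈ Submodule.span ℂ (Set.range (slotGen ω g)))
    (u : complexBetti B.X 1) : u ∈ Submodule.span ℂ (Set.range (colGen ω g)) := by
  have hBs : IsSmoothProjective B.dim B.X := Motives.AbelianVariety.isSmoothProjective_holds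
  obtain ⟨a, b, hab, ha, hb⟩ := exists_add_eq_of_isOfHodgeType_one hBs u
  have hle : Submodule.span ℂ (Set.range (slotGen ω g)) ≤ Submodule.span ℂ (Set.range (colGen ω g)) := by
    refine Submodule.span_mono ?_
    rintro _ ⟨j, rfl⟩
    exact ⟨(j, true), by simp [colGen]⟩
  have key : ∀ x ∈ Submodule.span ℂ (Set.range (slotGen ω g)),
      conjClass (Motives.ComplexPoints B.X) 1 x ∈ Submodule.span ℂ (Set.range (colGen ω g)) := by
    intro x hx
    induction hx using Submodule.span_induction with
    | mem x hx =>
      obtain ⟨j, rfl⟩ := hx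
      exact Submodule.subset_span ⟨(j, false), by simp [colGen]⟩
    | zero => rw [conjClass_zero]; exact Submodule.zero_mem _
    | add x y _ _ hx hy => rw [conjClass_add]; exact Submodule.add_mem _ hx hy
    | smul a x _ hx => rw [conjClass_smul]; exact Submodule.smul_mem _ _ hx
  rw [← hab]
  refine Submodule.add_mem _ (hle (hspan a ha)) ?_
  have h := key _ (hspan _ (hb.conjClass hBs))
  rwa [conjClass_conjClass] at h

omit [DecidableEq J] [DecidableEq L] in
/-- **`Hⁿ(B) = span {m_φ}`**: every class of degree `n` is a combination of monomials in the coloured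
generators (`H• = ⋀• H¹`, `AbelianVariety.hasExteriorCohomologyH1_complexPoints`, and the
expansion lemma). [cite: LangeBirkenhake1992, Lemma 1.1.17 and Thm. 4.2.1] -/
private theorem mem_span_mono
    (hspan : ∀ u : complexBetti B.X 1, IsOfHodgeType B.dim B.X 1 1 0 u →
      u ∈ Submodule.span ℂ (Set.range (slotGen ω g)))
    (n : ℕ) (c : complexBetti B.X n) : c ∈ Submodule.span ℂ (Set.range (mono ω g n)) := by
  have htop := (Motives.AbelianVariety.hasExteriorCohomologyH1_complexPoints B).span_range_cupPowOne n
  have hc : c ∈ Submodule.span ℂ (Set.range (cupPowOne ℂ (Motives.ComplexPoints B.X) n)) := by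
    rw [htop]; exact Submodule.mem_top
  refine (Submodule.span_le.2 ?_) hc
  rintro _ ⟨v, rfl⟩
  exact MultilinearMap.mem_span_range_comp_of_mem_span (cupPowOne ℂ (Motives.ComplexPoints B.X) n)
    (colGen ω g) v fun i ↦ mem_span_colGen hspan (v i)

/-! #### Good operators: diagonal on monomials, preserving rational classes and `(p,p)`-classes -/

variable (ω g) in
/-- An endomorphism `F` of `Hⁿ(B(ℂ); ℂ)` is **good with symbol `s`** if it multiplies every monomial
`m_φ` by the scalar `s φ`, maps rational classes to rational classes, and maps classes of type `(p,p)`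
to classes of type `(p,p)`. Pull-backs along endomorphisms of `B`, and `ℚ`-polynomials in them, are
good. [folklore] -/
private def GoodOp (n p : ℕ) (F : Module.End ℂ (complexBetti B.X n)) (s : (Fin n → J × Bool) → ℂ) : Prop :=
  (∀ φ, F (mono ω g n φ) = s φ • mono ω g n φ) ∧
  (∀ v : complexBetti B.X n, IsRationalClass v → IsRationalClass (F v)) ∧
  (∀ v : complexBetti B.X n, IsOfHodgeType B.dim B.X n p p v → IsOfHodgeType B.dim B.X n p p (F v))

omit [Fintype J] [DecidableEq L] in
/-- The slot operators are good, with symbol `φ ↦ ∏ᵢ ev_j(φ i)`. [cite: VoisinHodgeI2002, §7.3.2 and §11.3.1] -/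
private theorem goodOp_slotOp (hμω : ∀ b, complexBetti.map (ψ b).hom.hom.hom 1 (ω b) = μ b • ω b)
    (hμc : ∀ b, starRingEnd ℂ (μ b) = -μ b)
    (hTg : ∀ j, T j ≫ g j = g j ≫ ψ (ℓ j)) (hTg' : ∀ j i, i ≠ j → T j ≫ g i = g i) (j : J) (n p : ℕ) :
    GoodOp ω g n p (slotOp T j n) (fun φ ↦ ∏ i, slotEv μ ℓ j (φ i)) := by
  have hBs : IsSmoothProjective B.dim B.X := Motives.AbelianVariety.isSmoothProjective_holds
  refine ⟨fun φ ↦ slotOp_mono hμω hμc hTg hTg' j φ, fun v hv ↦ hv.map _, fun v hv ↦ ?_⟩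
  exact hv.map_of_isSmoothProjective hBs hBs (T j).hom.hom.hom

omit [Fintype J] [DecidableEq J] [DecidableEq L] in
/-- The identity is good with symbol `1`. [folklore] -/
private theorem goodOp_one (n p : ℕ) : GoodOp ω g n p (1 : Module.End ℂ (complexBetti B.X n)) (fun _ ↦ 1) :=
  ⟨fun φ ↦ by rw [Module.End.one_apply, one_smul], fun v hv ↦ hv, fun v hv ↦ hv⟩

omit [Fintype J] [DecidableEq J] [DecidableEq L] in
/-- Good operators are closed under composition (symbols multiply). [folklore] -/
private theorem GoodOp.mul {n p : ℕ} {F G : Module.End ℂ (complexBetti B.X n)} {s t : (Fin n → J × Bool) → ℂ}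
    (hF : GoodOp ω g n p F s) (hG : GoodOp ω g n p G t) : GoodOp ω g n p (F * G) (fun φ ↦ s φ * t φ) := by
  refine ⟨fun φ ↦ ?_, fun v hv ↦ hF.2.1 _ (hG.2.1 v hv), fun v hv ↦ hF.2.2 _ (hG.2.2 v hv)⟩
  rw [Module.End.mul_apply, hG.1 φ, map_smul, hF.1 φ, smul_smul, mul_comm]

omit [Fintype J] [DecidableEq J] [DecidableEq L] in
/-- Good operators are closed under addition. [folklore] -/
private theorem GoodOp.add {n p : ℕ} {F G : Module.End ℂ (complexBetti B.X n)} {s t : (Fin n → J × Bool) → ℂ}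
    (hF : GoodOp ω g n p F s) (hG : GoodOp ω g n p G t) : GoodOp ω g n p (F + G) (fun φ ↦ s φ + t φ) := by
  have hBs : IsSmoothProjective B.dim B.X := Motives.AbelianVariety.isSmoothProjective_holds
  refine ⟨fun φ ↦ ?_, fun v hv ↦ ?_, fun v hv ↦ ?_⟩
  · rw [LinearMap.add_apply, hF.1 φ, hG.1 φ, add_smul]
  · rw [LinearMap.add_apply]; exact (hF.2.1 v hv).add (hG.2.1 v hv)
  · rw [LinearMap.add_apply]; exact (hF.2.2 v hv).add hBs (hG.2.2 v hv)

omit [Fintype J] [DecidableEq J] [DecidableEq L] in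
/-- Good operators are closed under subtraction. [folklore] -/
private theorem GoodOp.sub {n p : ℕ} {F G : Module.End ℂ (complexBetti B.X n)} {s t : (Fin n → J × Bool) → ℂ}
    (hF : GoodOp ω g n p F s) (hG : GoodOp ω g n p G t) : GoodOp ω g n p (F - G) (fun φ ↦ s φ - t φ) := by
  have hBs : IsSmoothProjective B.dim B.X := Motives.AbelianVariety.isSmoothProjective_holds
  refine ⟨fun φ ↦ ?_, fun v hv ↦ ?_, fun v hv ↦ ?_⟩
  · rw [LinearMap.sub_apply, hF.1 φ, hG.1 φ, sub_smul]
  · rw [LinearMap.sub_apply, sub_eq_add_neg]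
    exact (hF.2.1 v hv).add (by simpa using (hG.2.1 v hv).smul (-1))
  · rw [LinearMap.sub_apply]; exact (hF.2.2 v hv).sub hBs (hG.2.2 v hv)

omit [Fintype J] [DecidableEq J] [DecidableEq L] in
/-- Good operators are closed under RATIONAL scalars. [folklore] -/
private theorem GoodOp.ratSmul {n p : ℕ} {F : Module.End ℂ (complexBetti B.X n)} {s : (Fin n → J × Bool) → ℂ}
    (hF : GoodOp ω g n p F s) (q : ℚ) : GoodOp ω g n p (((q : ℚ) : ℂ) • F) (fun φ ↦ (q : ℂ) * s φ) := by
  refine ⟨fun φ ↦ ?_, fun v hv ↦ ?_, fun v hv ↦ ?_⟩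
  · rw [LinearMap.smul_apply, hF.1 φ, smul_smul]
  · rw [LinearMap.smul_apply]; exact (hF.2.1 v hv).smul q
  · rw [LinearMap.smul_apply]; exact (hF.2.2 v hv).smul _

omit [Fintype J] [DecidableEq J] [DecidableEq L] in
/-- Good operators are closed under finite (ordered) products: a list of good operators has a good
product, with symbol the product of the symbols. [folklore] -/
private theorem GoodOp.listProd {n p : ℕ} {ι : Type*} (F : ι → Module.End ℂ (complexBetti B.X n))
    (s : ι → (Fin n → J × Bool) → ℂ) (hF : ∀ i, GoodOp ω g n p (F i) (s i)) :
    ∀ l : List ι, GoodOp ω g n p (l.map F).prod (fun φ ↦ (l.map fun i ↦ s i φ).prod)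
  | [] => by simpa using goodOp_one (ω := ω) (g := g) n p
  | i :: l => by
    simpa [List.map_cons, List.prod_cons] using (hF i).mul (GoodOp.listProd F s hF l)

omit [Fintype J] [DecidableEq J] [DecidableEq L] in
/-- A good operator maps the span of a set of monomials into the span of those monomials of the
set on which its symbol does not vanish; in particular into the span of the same set. [folklore] -/
private theorem GoodOp.apply_mem_span {n p : ℕ} {F : Module.End ℂ (complexBetti B.X n)}
    {s : (Fin n → J × Bool) → ℂ} (hF : GoodOp ω g n p F s) (S : Set (Fin n → J × Bool))
    {c : complexBetti B.X n} (hc : c ∈ Submodule.span ℂ (mono ω g n '' S)) :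
    F c ∈ Submodule.span ℂ (mono ω g n '' {φ : Fin n → J × Bool | φ ∈ S ∧ s φ ≠ 0}) := by
  have hle : Submodule.span ℂ (mono ω g n '' S) ≤
      (Submodule.span ℂ (mono ω g n '' {φ : Fin n → J × Bool | φ ∈ S ∧ s φ ≠ 0})).comap F := by
    refine Submodule.span_le.2 ?_
    rintro _ ⟨φ, hφ, rfl⟩
    rw [SetLike.mem_coe, Submodule.mem_comap, hF.1 φ]
    by_cases hs : s φ = 0
    · rw [hs, zero_smul]; exact Submodule.zero_mem _
    · exact Submodule.smul_mem _ _ (Submodule.subset_span ⟨φ, ⟨hφ, hs⟩, rfl⟩)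
  exact hle hc

/-! #### Occupation, colour and key of a word; the symbols on injective words -/

/-- Slot `j` is OCCUPIED with colour `c` in the word `φ`: the generator `z_{(j,c)}` occurs. [folklore] -/
private def Occ {n : ℕ} (φ : Fin n → J × Bool) (j : J) (c : Bool) : Prop := ∃ i, φ i = (j, c)

/-- Occupation is decidable (finite word). [folklore] -/
private instance {n : ℕ} (φ : Fin n → J × Bool) (j : J) (c : Bool) : Decidable (Occ φ j c) := by
  unfold Occ; infer_instance

/-- Slot `j` is SINGLY occupied in `φ`: exactly one of `x_j`, `x̄_j` occurs. [folklore] -/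
private def Single {n : ℕ} (φ : Fin n → J × Bool) (j : J) : Prop :=
  (Occ φ j true ∧ ¬ Occ φ j false) ∨ (Occ φ j false ∧ ¬ Occ φ j true)

/-- Single occupation is decidable. [folklore] -/
private instance {n : ℕ} (φ : Fin n → J × Bool) (j : J) : Decidable (Single φ j) := by
  unfold Single; infer_instance

/-- The COLOUR of slot `j` in `φ` (`tt` iff `x_j` occurs; meaningful on singly occupied slots). [folklore] -/
private def col {n : ℕ} (φ : Fin n → J × Bool) (j : J) : Bool := decide (Occ φ j true)

variable (ℓ) in
/-- The KEY of a word: its set of singly occupied slots, and the colour-agreement relation on pairs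
of distinct singly occupied slots with the same label (the colouring up to a global flip per label).
[folklore] -/
private def key {n : ℕ} (φ : Fin n → J × Bool) : Finset J × (J → J → Bool) :=
  (Finset.univ.filter fun j ↦ Single φ j,
    fun j j' ↦ decide (Single φ j ∧ Single φ j' ∧ j ≠ j' ∧ ℓ j = ℓ j' ∧ col φ j = col φ j'))

omit [Fintype J] in
/-- On an injective word a generator occurs at most once: `#{i | φ i = a} ∈ {0, 1}`. [folklore] -/
private theorem prod_ite_eq_of_injective {n : ℕ} {φ : Fin n → J × Bool} (hφ : Function.Injective φ)
    (a : J × Bool) (t : ℂ) : (∏ i, if φ i = a then t else 1) = if Occ φ a.1 a.2 then t else 1 := by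
  rw [Finset.prod_ite_one Finset.univ (fun i ↦ φ i = a)
    (fun i _ i' _ hi hi' ↦ hφ (hi.trans hi'.symm)) t]
  simp [Occ]

omit [Fintype J] [DecidableEq L] in
/-- **The symbol of `T_j^*` on an injective word**: `μ^{[x_j occurs]} (-μ)^{[x̄_j occurs]}`. [folklore] -/
private theorem prod_slotEv_eq_of_injective {n : ℕ} {φ : Fin n → J × Bool} (hφ : Function.Injective φ) (j : J) :
    (∏ i, slotEv μ ℓ j (φ i)) =
      (if Occ φ j true then μ (ℓ j) else 1) * (if Occ φ j false then -μ (ℓ j) else 1) := by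
  have h : ∀ a : J × Bool, slotEv μ ℓ j a =
      (if a = (j, true) then μ (ℓ j) else 1) * (if a = (j, false) then -μ (ℓ j) else 1) := by
    rintro ⟨i, c⟩
    by_cases hij : i = j
    · subst hij; cases c <;> simp [slotEv]
    · simp [slotEv, hij]
  simp_rw [h, Finset.prod_mul_distrib, prod_ite_eq_of_injective hφ]

/-- The Lagrange coefficient `((-d-1)(-d-d²))⁻¹` of the projector "slot `j` singly occupied". [folklore] -/
private def singCoeff (d : ℕ) : ℚ := ((-(d : ℚ) - 1) * (-(d : ℚ) - (d : ℚ) ^ 2))⁻¹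

/-- The symbol of the projector "slot `j` singly occupied". [folklore] -/
private def singSymbol (μ : L → ℂ) (ℓ : J → L) (d : L → ℕ) (j : J) {n : ℕ} (φ : Fin n → J × Bool) : ℂ :=
  (singCoeff (d (ℓ j)) : ℂ) *
    (((∏ i, slotEv μ ℓ j (φ i)) * (∏ i, slotEv μ ℓ j (φ i)) - 1) *
      ((∏ i, slotEv μ ℓ j (φ i)) * (∏ i, slotEv μ ℓ j (φ i)) - (((d (ℓ j) : ℚ) ^ 2 : ℚ) : ℂ) * 1))

omit [Fintype J] [DecidableEq L] in
/-- **On an injective word the single-occupation symbol is the indicator of "slot `j` singly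
occupied"** (`T_j^{*2}` has eigenvalue `-d` there, `1` on an empty slot, `d²` on a doubly occupied
one). [folklore] -/
private theorem singSymbol_eq_of_injective {d : L → ℕ} (hd : ∀ b, 0 < d b) (hμ2 : ∀ b, μ b ^ 2 = -(d b : ℂ))
    {n : ℕ} {φ : Fin n → J × Bool} (hφ : Function.Injective φ) (j : J) :
    singSymbol μ ℓ d j φ = if Single φ j then 1 else 0 := by
  unfold singSymbol
  rw [prod_slotEv_eq_of_injective hφ]
  set m := μ (ℓ j) with hm
  set D : ℂ := (d (ℓ j) : ℂ) with hD
  have hμ : m ^ 2 = -D := hμ2 (ℓ j)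
  have hd0 : (0 : ℚ) < d (ℓ j) := by exact_mod_cast hd (ℓ j)
  have hc : ((singCoeff (d (ℓ j)) : ℚ) : ℂ) * ((-D - 1) * (-D - D ^ 2)) = 1 := by
    have hne : ((-(d (ℓ j) : ℚ) - 1) * (-(d (ℓ j) : ℚ) - (d (ℓ j) : ℚ) ^ 2)) ≠ 0 := by
      apply mul_ne_zero <;> nlinarith
    have h : ((singCoeff (d (ℓ j)) : ℚ) : ℂ) *
        ((((-(d (ℓ j) : ℚ) - 1) * (-(d (ℓ j) : ℚ) - (d (ℓ j) : ℚ) ^ 2)) : ℚ) : ℂ) = 1 := by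
      rw [← Rat.cast_mul, singCoeff, inv_mul_cancel₀ hne, Rat.cast_one]
    push_cast at h
    exact h
  have hcast : (((d (ℓ j) : ℚ) ^ 2 : ℚ) : ℂ) = D ^ 2 := by push_cast; rw [hD]
  rw [hcast]
  by_cases h1 : Occ φ j true <;> by_cases h2 : Occ φ j false
  · -- doubly occupied: `(μ · (-μ))² = d²`, the second Lagrange factor vanishes
    have hS : (if Single φ j then (1 : ℂ) else 0) = 0 := by simp [Single, h1, h2]
    rw [hS]
    simp only [h1, h2, if_true]
    have e : m * -m * (m * -m) = D ^ 2 := by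
      rw [show m * -m * (m * -m) = (m ^ 2) ^ 2 by ring, hμ]; ring
    rw [e]; ring
  · -- colour `tt` only: `μ² = -d`
    have hS : (if Single φ j then (1 : ℂ) else 0) = 1 := by simp [Single, h1, h2]
    rw [hS]
    simp only [h1, h2, if_true, if_false, mul_one]
    have e : m * m = -D := by rw [← hμ]; ring
    rw [e]; linear_combination hc
  · -- colour `ff` only: `(-μ)² = -d`
    have hS : (if Single φ j then (1 : ℂ) else 0) = 1 := by simp [Single, h1, h2]
    rw [hS]
    simp only [h1, h2, if_true, if_false, one_mul]
    have e : -m * -m = -D := by rw [← hμ]; ring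
    rw [e]; linear_combination hc
  · -- empty slot: the first Lagrange factor vanishes
    have hS : (if Single φ j then (1 : ℂ) else 0) = 0 := by simp [Single, h1, h2]
    rw [hS]
    simp only [h1, h2, if_false, mul_one]
    ring

omit [Fintype J] [DecidableEq L] in
/-- On a singly occupied slot of an injective word the symbol of `T_j^*` is `μ` or `-μ` according to
the colour. [folklore] -/
private theorem prod_slotEv_eq_of_single {n : ℕ} {φ : Fin n → J × Bool} (hφ : Function.Injective φ) {j : J}
    (hj : Single φ j) : (∏ i, slotEv μ ℓ j (φ i)) = if col φ j then μ (ℓ j) else -μ (ℓ j) := by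
  rw [prod_slotEv_eq_of_injective hφ]
  unfold col
  rcases hj with ⟨h1, h2⟩ | ⟨h1, h2⟩ <;> simp [h1, h2]

/-- The Lagrange coefficient `(2t)⁻¹`, `t = ∓d`, of the pair projector. [folklore] -/
private def pairTarget (d : ℕ) (a : Bool) : ℚ := if a then -(d : ℚ) else (d : ℚ)

/-- The symbol of the pair projector "the colours of the singly occupied slots `j ≠ j'` (same label)
agree iff `a`". [folklore] -/
private def pairSymbol (μ : L → ℂ) (ℓ : J → L) (d : L → ℕ) (j j' : J) (a : Bool) {n : ℕ}
    (φ : Fin n → J × Bool) : ℂ :=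
  ((2 * pairTarget (d (ℓ j)) a)⁻¹ : ℚ) *
    ((∏ i, slotEv μ ℓ j (φ i)) * (∏ i, slotEv μ ℓ j' (φ i)) + (pairTarget (d (ℓ j)) a : ℚ) * 1)

omit [Fintype J] [DecidableEq L] in
/-- **On an injective word with `j ≠ j'` singly occupied and of the same label, the pair symbol is the
indicator of "colours agree iff `a`"** (`T_j^* T_{j'}^*` has eigenvalue `μ² = -d` if the colours
agree and `-μ² = d` if not). [folklore] -/
private theorem pairSymbol_eq_of_injective {d : L → ℕ} (hd : ∀ b, 0 < d b) (hμ2 : ∀ b, μ b ^ 2 = -(d b : ℂ))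
    {n : ℕ} {φ : Fin n → J × Bool} (hφ : Function.Injective φ) {j j' : J} (hj : Single φ j)
    (hj' : Single φ j') (hl : ℓ j = ℓ j') (a : Bool) :
    pairSymbol μ ℓ d j j' a φ = if decide (col φ j = col φ j') = a then 1 else 0 := by
  have hD0 : (d (ℓ j) : ℂ) ≠ 0 := by exact_mod_cast (hd (ℓ j)).ne'
  have e : μ (ℓ j) * μ (ℓ j) = -(d (ℓ j) : ℂ) := by rw [← hμ2 (ℓ j)]; ring
  have hprod : (∏ i, slotEv μ ℓ j (φ i)) * (∏ i, slotEv μ ℓ j' (φ i)) =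
      if col φ j = col φ j' then -(d (ℓ j) : ℂ) else (d (ℓ j) : ℂ) := by
    rw [prod_slotEv_eq_of_single hφ hj, prod_slotEv_eq_of_single hφ hj', ← hl]
    cases col φ j <;> cases col φ j' <;> simp <;>
      first | linear_combination e | linear_combination (-1 : ℂ) * e
  have ht : ((pairTarget (d (ℓ j)) a : ℚ) : ℂ) = if a then -(d (ℓ j) : ℂ) else (d (ℓ j) : ℂ) := by
    unfold pairTarget; split_ifs <;> push_cast <;> rfl
  have hc : (((2 * pairTarget (d (ℓ j)) a)⁻¹ : ℚ) : ℂ) = (2 * (if a then -(d (ℓ j) : ℂ) else (d (ℓ j) : ℂ)))⁻¹ := by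
    push_cast; rw [ht]
  unfold pairSymbol
  rw [hprod, hc, ht]
  rcases Bool.eq_false_or_eq_true a with rfl | rfl <;> by_cases hcc : col φ j = col φ j' <;>
    simp [hcc] <;> field_simp <;> ring

/-- The operator "slot `j` singly occupied": the Lagrange idempotent of `T_j^{*2}` at the eigenvalue
`-d` (a `ℚ`-polynomial in the slot operator). [folklore] -/
private def singOp (T : J → (B ⟶ B)) (ℓ : J → L) (d : L → ℕ) (j : J) (n : ℕ) :
    Module.End ℂ (complexBetti B.X n) :=
  ((singCoeff (d (ℓ j)) : ℚ) : ℂ) •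
    ((slotOp T j n * slotOp T j n - 1) *
      (slotOp T j n * slotOp T j n - ((((d (ℓ j) : ℚ) ^ 2 : ℚ) : ℂ) • 1)))

/-- The operator of the pair condition: the Lagrange idempotent of `T_j^* T_{j'}^*` at `∓d`. [folklore] -/
private def pairOp (T : J → (B ⟶ B)) (ℓ : J → L) (d : L → ℕ) (j j' : J) (a : Bool) (n : ℕ) :
    Module.End ℂ (complexBetti B.X n) :=
  (((2 * pairTarget (d (ℓ j)) a)⁻¹ : ℚ) : ℂ) •
    (slotOp T j n * slotOp T j' n + ((pairTarget (d (ℓ j)) a : ℚ) : ℂ) • 1)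

omit [Fintype J] [DecidableEq L] in
/-- `singOp` is good with symbol `singSymbol`. [folklore] -/
private theorem goodOp_singOp (hμω : ∀ b, complexBetti.map (ψ b).hom.hom.hom 1 (ω b) = μ b • ω b)
    (hμc : ∀ b, starRingEnd ℂ (μ b) = -μ b)
    (hTg : ∀ j, T j ≫ g j = g j ≫ ψ (ℓ j)) (hTg' : ∀ j i, i ≠ j → T j ≫ g i = g i) (d : L → ℕ)
    (j : J) (n p : ℕ) : GoodOp ω g n p (singOp T ℓ d j n) (singSymbol μ ℓ d j) := by
  have hT := goodOp_slotOp hμω hμc hTg hTg' j n p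
  have h1 := goodOp_one (ω := ω) (g := g) n p
  exact (((hT.mul hT).sub h1).mul ((hT.mul hT).sub (h1.ratSmul _))).ratSmul _

omit [Fintype J] [DecidableEq L] in
/-- `pairOp` is good with symbol `pairSymbol`. [folklore] -/
private theorem goodOp_pairOp (hμω : ∀ b, complexBetti.map (ψ b).hom.hom.hom 1 (ω b) = μ b • ω b)
    (hμc : ∀ b, starRingEnd ℂ (μ b) = -μ b)
    (hTg : ∀ j, T j ≫ g j = g j ≫ ψ (ℓ j)) (hTg' : ∀ j i, i ≠ j → T j ≫ g i = g i) (d : L → ℕ)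
    (j j' : J) (a : Bool) (n p : ℕ) : GoodOp ω g n p (pairOp T ℓ d j j' a n) (pairSymbol μ ℓ d j j' a) := by
  have hT := goodOp_slotOp hμω hμc hTg hTg' j n p
  have hT' := goodOp_slotOp hμω hμc hTg hTg' j' n p
  have h1 := goodOp_one (ω := ω) (g := g) n p
  exact ((hT.mul hT').add (h1.ratSmul _)).ratSmul _

variable (ℓ) in
/-- The tested pairs of a key: ordered pairs of distinct singly occupied slots with the same label. [folklore] -/
private def keyPairs (κ : Finset J × (J → J → Bool)) : Finset (J × J) :=
  (κ.1 ×ˢ κ.1).filter fun x ↦ x.1 ≠ x.2 ∧ ℓ x.1 = ℓ x.2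

/-- **The key projector** `P_κ`: the product of the single-occupation idempotents (or their
complements) over all slots and of the pair idempotents over the tested pairs of `κ`. [folklore] -/
private def keyOp (T : J → (B ⟶ B)) (ℓ : J → L) (d : L → ℕ) (κ : Finset J × (J → J → Bool)) (n : ℕ) :
    Module.End ℂ (complexBetti B.X n) :=
  ((Finset.univ : Finset J).toList.map fun j ↦
      if j ∈ κ.1 then singOp T ℓ d j n else 1 - singOp T ℓ d j n).prod *
    ((keyPairs ℓ κ).toList.map fun x ↦ pairOp T ℓ d x.1 x.2 (κ.2 x.1 x.2) n).prod

/-- The symbol of the key projector. [folklore] -/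
private def keySymbol (μ : L → ℂ) (ℓ : J → L) (d : L → ℕ) (κ : Finset J × (J → J → Bool)) {n : ℕ}
    (φ : Fin n → J × Bool) : ℂ :=
  (∏ j, if j ∈ κ.1 then singSymbol μ ℓ d j φ else 1 - singSymbol μ ℓ d j φ) *
    ∏ x ∈ keyPairs ℓ κ, pairSymbol μ ℓ d x.1 x.2 (κ.2 x.1 x.2) φ

/-- `keyOp` is good with symbol `keySymbol`. [folklore] -/
private theorem goodOp_keyOp (hμω : ∀ b, complexBetti.map (ψ b).hom.hom.hom 1 (ω b) = μ b • ω b)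
    (hμc : ∀ b, starRingEnd ℂ (μ b) = -μ b)
    (hTg : ∀ j, T j ≫ g j = g j ≫ ψ (ℓ j)) (hTg' : ∀ j i, i ≠ j → T j ≫ g i = g i) (d : L → ℕ)
    (κ : Finset J × (J → J → Bool)) (n p : ℕ) : GoodOp ω g n p (keyOp T ℓ d κ n) (keySymbol μ ℓ d κ) := by
  have hA := GoodOp.listProd (ω := ω) (g := g) (n := n) (p := p)
    (fun j ↦ if j ∈ κ.1 then singOp T ℓ d j n else 1 - singOp T ℓ d j n)
    (fun j φ ↦ if j ∈ κ.1 then singSymbol μ ℓ d j φ else 1 - singSymbol μ ℓ d j φ)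
    (fun j ↦ by
      by_cases hj : j ∈ κ.1
      · simpa [hj] using goodOp_singOp hμω hμc hTg hTg' d j n p
      · simpa [hj] using (goodOp_one (ω := ω) (g := g) n p).sub (goodOp_singOp hμω hμc hTg hTg' d j n p))
    (Finset.univ : Finset J).toList
  have hB := GoodOp.listProd (ω := ω) (g := g) (n := n) (p := p)
    (fun x : J × J ↦ pairOp T ℓ d x.1 x.2 (κ.2 x.1 x.2) n)
    (fun x φ ↦ pairSymbol μ ℓ d x.1 x.2 (κ.2 x.1 x.2) φ)
    (fun x ↦ goodOp_pairOp hμω hμc hTg hTg' d x.1 x.2 _ n p) (keyPairs ℓ κ).toList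
  have h := hA.mul hB
  refine ⟨fun φ ↦ ?_, h.2.1, h.2.2⟩
  unfold keyOp keySymbol
  simpa only [Finset.prod_map_toList] using h.1 φ

omit [Fintype J] in
/-- Two words have the same key iff they have the same singly occupied slots and, on every tested
pair, the same colour agreement. [folklore] -/
private theorem key_eq_iff {n n' : ℕ} (φ : Fin n → J × Bool) (φ₀ : Fin n' → J × Bool) [Fintype J] :
    key ℓ φ = key ℓ φ₀ ↔ (∀ j, Single φ j ↔ Single φ₀ j) ∧
      ∀ j j', Single φ₀ j → Single φ₀ j' → j ≠ j' → ℓ j = ℓ j' →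
        (col φ j = col φ j' ↔ col φ₀ j = col φ₀ j') := by
  constructor
  · intro h
    have h1 : ∀ j, Single φ j ↔ Single φ₀ j := by
      intro j
      have := congrArg (fun κ : Finset J × (J → J → Bool) ↦ j ∈ κ.1) h
      simpa [key] using this
    refine ⟨h1, fun j j' hj hj' hne hl ↦ ?_⟩
    have h2 := congrArg (fun κ : Finset J × (J → J → Bool) ↦ κ.2 j j') h
    change decide (Single φ j ∧ Single φ j' ∧ j ≠ j' ∧ ℓ j = ℓ j' ∧ col φ j = col φ j') =
      decide (Single φ₀ j ∧ Single φ₀ j' ∧ j ≠ j' ∧ ℓ j = ℓ j' ∧ col φ₀ j = col φ₀ j') at h2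
    rw [decide_eq_decide] at h2
    simp only [(h1 j), (h1 j'), hj, hj', ne_eq, hne, not_false_eq_true, hl, true_and] at h2
    exact h2
  · rintro ⟨h1, h2⟩
    unfold key
    refine Prod.ext ?_ ?_
    · ext j; simp [h1 j]
    · funext j j'
      change decide (Single φ j ∧ Single φ j' ∧ j ≠ j' ∧ ℓ j = ℓ j' ∧ col φ j = col φ j') =
        decide (Single φ₀ j ∧ Single φ₀ j' ∧ j ≠ j' ∧ ℓ j = ℓ j' ∧ col φ₀ j = col φ₀ j')
      rw [decide_eq_decide, h1 j, h1 j']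
      constructor
      · rintro ⟨hj, hj', hne, hl, hc⟩
        exact ⟨hj, hj', hne, hl, (h2 j j' hj hj' hne hl).1 hc⟩
      · rintro ⟨hj, hj', hne, hl, hc⟩
        exact ⟨hj, hj', hne, hl, (h2 j j' hj hj' hne hl).2 hc⟩

/-- **The key symbol on an injective word is the indicator of the key class.** [folklore] -/
private theorem keySymbol_eq_of_injective {d : L → ℕ} (hd : ∀ b, 0 < d b) (hμ2 : ∀ b, μ b ^ 2 = -(d b : ℂ))
    {n n' : ℕ} {φ : Fin n → J × Bool} (hφ : Function.Injective φ) (φ₀ : Fin n' → J × Bool) :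
    keySymbol μ ℓ d (key ℓ φ₀) φ = if key ℓ φ = key ℓ φ₀ then 1 else 0 := by
  unfold keySymbol
  have hs : ∀ j, (if j ∈ (key ℓ φ₀).1 then singSymbol μ ℓ d j φ else 1 - singSymbol μ ℓ d j φ) =
      if (Single φ j ↔ Single φ₀ j) then 1 else 0 := by
    intro j
    rw [singSymbol_eq_of_injective hd hμ2 hφ]
    have hm : j ∈ (key ℓ φ₀).1 ↔ Single φ₀ j := by simp [key]
    by_cases h0 : Single φ₀ j <;> by_cases h1 : Single φ j <;> simp [hm, h0, h1]
  simp_rw [hs, Finset.prod_boole]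
  by_cases hO : ∀ j, Single φ j ↔ Single φ₀ j
  · rw [if_pos (fun j _ ↦ hO j), one_mul]
    have hp : ∀ x ∈ keyPairs ℓ (key ℓ φ₀),
        pairSymbol μ ℓ d x.1 x.2 ((key ℓ φ₀).2 x.1 x.2) φ =
          if (col φ x.1 = col φ x.2 ↔ col φ₀ x.1 = col φ₀ x.2) then 1 else 0 := by
      intro x hx
      simp only [keyPairs, key, Finset.mem_filter, Finset.mem_product, Finset.mem_univ, true_and] at hx
      obtain ⟨⟨hj, hj'⟩, hne, hl⟩ := hx
      rw [pairSymbol_eq_of_injective hd hμ2 hφ ((hO _).2 hj) ((hO _).2 hj') hl]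
      simp only [key, hj, hj', ne_eq, hne, not_false_eq_true, hl, true_and]
      by_cases h : col φ x.1 = col φ x.2 <;> by_cases h' : col φ₀ x.1 = col φ₀ x.2 <;> simp [h, h']
    rw [Finset.prod_congr rfl hp, Finset.prod_boole]
    by_cases hA : ∀ j j', Single φ₀ j → Single φ₀ j' → j ≠ j' → ℓ j = ℓ j' →
        (col φ j = col φ j' ↔ col φ₀ j = col φ₀ j')
    · rw [if_pos, if_pos ((key_eq_iff φ φ₀).2 ⟨hO, hA⟩)]
      intro x hx
      simp only [keyPairs, key, Finset.mem_filter, Finset.mem_product, Finset.mem_univ, true_and] at hx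
      exact hA x.1 x.2 hx.1.1 hx.1.2 hx.2.1 hx.2.2
    · rw [if_neg, if_neg (fun h ↦ hA ((key_eq_iff φ φ₀).1 h).2)]
      intro h
      apply hA
      intro j j' hj hj' hne hl
      exact h (j, j') (by simp [keyPairs, key, hj, hj', hne, hl])
  · rw [if_neg (fun h ↦ hO fun j ↦ h j (Finset.mem_univ j)), zero_mul,
      if_neg (fun h ↦ hO ((key_eq_iff φ φ₀).1 h).1)]

omit [Fintype J] [DecidableEq J] [DecidableEq L] in
/-- A word with a repeated generator has vanishing monomial (`x ⌣ x = 0` in degree one). [folklore] -/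
private theorem mono_eq_zero_of_not_injective {n : ℕ} {φ : Fin n → J × Bool} (hφ : ¬ Function.Injective φ) :
    mono ω g n φ = 0 := by
  unfold mono
  simp only [Function.Injective, not_forall] at hφ
  obtain ⟨i, i', h, hne⟩ := hφ
  exact cupPowOne_eq_zero_of_eq n _ i i' (by simp [h]) hne

/-- **The key projectors sum to the identity**: `∑_κ P_κ c = c` for every `c ∈ H²ᵖ(B)` (they do so
on every monomial, and the monomials span). [folklore] -/
private theorem sum_keyOp_apply (hμω : ∀ b, complexBetti.map (ψ b).hom.hom.hom 1 (ω b) = μ b • ω b)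
    {d : L → ℕ} (hd : ∀ b, 0 < d b) (hμ2 : ∀ b, μ b ^ 2 = -(d b : ℂ))
    (hTg : ∀ j, T j ≫ g j = g j ≫ ψ (ℓ j)) (hTg' : ∀ j i, i ≠ j → T j ≫ g i = g i)
    (hspan : ∀ u : complexBetti B.X 1, IsOfHodgeType B.dim B.X 1 1 0 u →
      u ∈ Submodule.span ℂ (Set.range (slotGen ω g)))
    (n : ℕ) (c : complexBetti B.X n) :
    (∑ κ ∈ (Finset.univ : Finset (Fin n → J × Bool)).image (key ℓ), keyOp T ℓ d κ n c) = c := by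
  have hμc : ∀ b, starRingEnd ℂ (μ b) = -μ b := fun b ↦ conj_eq_neg_of_sq_eq_neg_aux (hd b) (hμ2 b)
  set Ψ : Module.End ℂ (complexBetti B.X n) :=
    ∑ κ ∈ (Finset.univ : Finset (Fin n → J × Bool)).image (key ℓ), keyOp T ℓ d κ n with hΨ
  suffices h : ∀ φ, Ψ (mono ω g n φ) = mono ω g n φ by
    have hle : Submodule.span ℂ (Set.range (mono ω g n)) ≤ LinearMap.ker (Ψ - 1) := by
      refine Submodule.span_le.2 ?_
      rintro _ ⟨φ, rfl⟩
      simp [h φ]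
    have hc := hle (mem_span_mono hspan n c)
    rw [LinearMap.mem_ker, LinearMap.sub_apply, Module.End.one_apply, sub_eq_zero, hΨ,
      LinearMap.sum_apply] at hc
    exact hc
  intro φ
  by_cases hφ : Function.Injective φ
  · rw [hΨ, LinearMap.sum_apply]
    have hterm : ∀ κ ∈ (Finset.univ : Finset (Fin n → J × Bool)).image (key ℓ),
        keyOp T ℓ d κ n (mono ω g n φ) = (if key ℓ φ = κ then (1 : ℂ) else 0) • mono ω g n φ := by
      intro κ hκ
      obtain ⟨φ₀, -, rfl⟩ := Finset.mem_image.1 hκ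
      rw [(goodOp_keyOp hμω hμc hTg hTg' d (key ℓ φ₀) n 0).1 φ, keySymbol_eq_of_injective hd hμ2 hφ φ₀]
    rw [Finset.sum_congr rfl hterm, ← Finset.sum_smul, Finset.sum_ite_eq]
    simp
  · rw [mono_eq_zero_of_not_injective hφ, map_zero]

/-! #### Counting colours and labels; the key class of a word up to flips -/

variable (ℓ) in
/-- Number of letters of `φ` with label `b` and colour `c`. [folklore] -/
private def cntLC {n : ℕ} (φ : Fin n → J × Bool) (b : L) (c : Bool) : ℕ :=
  ∑ i, if ℓ (φ i).1 = b ∧ (φ i).2 = c then 1 else 0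

/-- Number of letters of `φ` of colour `c` (the Hodge type of `m_φ` is `(# tt, # ff)`). [folklore] -/
private def cntC {n : ℕ} (φ : Fin n → J × Bool) (c : Bool) : ℕ := ∑ i, if (φ i).2 = c then 1 else 0

variable (ℓ) in
/-- A word is BALANCED if for each label it has as many letters of colour `tt` as of colour `ff`
(then `m_φ` is, up to sign, a product of cross classes `x_j ⌣ x̄_{j'}` with `ℓ j = ℓ j'`). [folklore] -/
private def Balanced {n : ℕ} (φ : Fin n → J × Bool) : Prop := ∀ b, cntLC ℓ φ b true = cntLC ℓ φ b false

variable (ℓ) in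
/-- The singly occupied slots of `φ` with label `b` and colour `c`. [folklore] -/
private def slotsSC {n : ℕ} (φ : Fin n → J × Bool) (b : L) (c : Bool) : Finset J :=
  Finset.univ.filter fun j ↦ ℓ j = b ∧ Single φ j ∧ col φ j = c

variable (ℓ) in
/-- The doubly occupied slots of `φ` with label `b`. [folklore] -/
private def slotsD {n : ℕ} (φ : Fin n → J × Bool) (b : L) : Finset J :=
  Finset.univ.filter fun j ↦ ℓ j = b ∧ Occ φ j true ∧ Occ φ j false

omit [Fintype J] [DecidableEq J] in
/-- `# tt + # ff = n`. [folklore] -/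
private theorem cntC_true_add_cntC_false {n : ℕ} (φ : Fin n → J × Bool) : cntC φ true + cntC φ false = n := by
  unfold cntC
  rw [← Finset.sum_add_distrib]
  have h : ∀ i, ((if (φ i).2 = true then 1 else 0) + (if (φ i).2 = false then 1 else 0) : ℕ) = 1 := by
    intro i; cases (φ i).2 <;> simp
  simp_rw [h]
  simp

omit [Fintype J] [DecidableEq J] in
/-- `# c = ∑_{labels l} #(l, c)` (finitely many labels). [folklore] -/
private theorem cntC_eq_sum [Fintype L] {n : ℕ} (φ : Fin n → J × Bool) (c : Bool) :
    cntC φ c = ∑ l, cntLC ℓ φ l c := by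
  unfold cntC cntLC
  rw [Finset.sum_comm]
  refine Finset.sum_congr rfl fun i _ ↦ ?_
  by_cases h : (φ i).2 = c
  · simp only [h, and_true]
    rw [Finset.sum_ite_eq]
    simp
  · simp [h]

omit [Fintype J] [DecidableEq J] in
/-- A balanced word has as many `tt`- as `ff`-letters. [folklore] -/
private theorem cntC_eq_of_balanced [Fintype L] {n : ℕ} {φ : Fin n → J × Bool} (h : Balanced ℓ φ) :
    cntC φ true = cntC φ false := by
  rw [cntC_eq_sum (ℓ := ℓ), cntC_eq_sum (ℓ := ℓ)]
  exact Finset.sum_congr rfl fun l _ ↦ h l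

omit [Fintype J] [DecidableEq J] in
/-- Counts are invariant under reordering the letters. [folklore] -/
private theorem cntLC_comp_perm {n : ℕ} (φ : Fin n → J × Bool) (σ : Equiv.Perm (Fin n)) (b : L) (c : Bool) :
    cntLC ℓ (φ ∘ σ) b c = cntLC ℓ φ b c := by
  unfold cntLC
  exact Equiv.sum_comp σ (fun i ↦ if ℓ (φ i).1 = b ∧ (φ i).2 = c then 1 else 0)

/-- **Counting letters through slots** (injective word): the letters of label `b` and colour `c`
correspond to the singly occupied slots of label `b` and colour `c` together with the doubly occupied
slots of label `b`. [folklore] -/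
private theorem cntLC_eq_card_of_injective {n : ℕ} {φ : Fin n → J × Bool} (hφ : Function.Injective φ)
    (b : L) (c : Bool) : cntLC ℓ φ b c = (slotsSC ℓ φ b c).card + (slotsD ℓ φ b).card := by
  classical
  unfold cntLC
  rw [Finset.sum_boole]
  -- letters ↔ occupied slots of colour `c`
  have h1 : (Finset.univ.filter fun i : Fin n ↦ ℓ (φ i).1 = b ∧ (φ i).2 = c).card =
      (Finset.univ.filter fun j : J ↦ ℓ j = b ∧ Occ φ j c).card := by
    refine Finset.card_bij (fun i _ ↦ (φ i).1) ?_ ?_ ?_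
    · intro i hi
      simp only [Finset.mem_filter, Finset.mem_univ, true_and] at hi ⊢
      exact ⟨hi.1, i, Prod.ext rfl hi.2⟩
    · intro i hi i' hi' h
      simp only [Finset.mem_filter, Finset.mem_univ, true_and] at hi hi'
      exact hφ (Prod.ext h (hi.2.trans hi'.2.symm))
    · intro j hj
      simp only [Finset.mem_filter, Finset.mem_univ, true_and] at hj
      obtain ⟨hb, i, hi⟩ := hj
      exact ⟨i, by simp [hi, hb], by simp [hi]⟩
  -- occupied slots of colour `c` = singles of colour `c` ⊔ doubles
  have h2 : (Finset.univ.filter fun j : J ↦ ℓ j = b ∧ Occ φ j c) = slotsSC ℓ φ b c ∪ slotsD ℓ φ b := by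
    ext j
    simp only [slotsSC, slotsD, Single, col, Finset.mem_filter, Finset.mem_univ, true_and,
      Finset.mem_union]
    cases c <;> by_cases ht : Occ φ j true <;> by_cases hf : Occ φ j false <;> simp [ht, hf]
  have h3 : Disjoint (slotsSC ℓ φ b c) (slotsD ℓ φ b) := by
    rw [Finset.disjoint_left]
    intro j hj hj'
    simp only [slotsSC, slotsD, Finset.mem_filter, Finset.mem_univ, true_and] at hj hj'
    rcases hj.2.1 with ⟨_, h⟩ | ⟨_, h⟩
    · exact h hj'.2.2
    · exact h hj'.2.1
  simp only [Nat.cast_id]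
  rw [h1, h2, Finset.card_union_of_disjoint h3]

/-- Balance read on slots (injective word): as many `tt`-coloured as `ff`-coloured SINGLY occupied
slots of each label (doubly occupied slots contribute one letter of each colour). [folklore] -/
private theorem balanced_iff_of_injective {n : ℕ} {φ : Fin n → J × Bool} (hφ : Function.Injective φ) :
    Balanced ℓ φ ↔ ∀ b, (slotsSC ℓ φ b true).card = (slotsSC ℓ φ b false).card := by
  unfold Balanced
  simp_rw [cntLC_eq_card_of_injective hφ]
  exact forall_congr' fun b ↦ Nat.add_right_cancel_iff

omit [Fintype J] in
/-- **The flip dichotomy**: two injective words with the same key have, for each label, either the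
same colour on all singly occupied slots of that label or the opposite colour on all of them. [folklore] -/
private theorem col_agree_or_disagree [Fintype J] {n n' : ℕ} {φ : Fin n → J × Bool} {φ' : Fin n' → J × Bool}
    (h : key ℓ φ = key ℓ φ') (b : L) :
    (∀ j, ℓ j = b → Single φ j → col φ j = col φ' j) ∨
      (∀ j, ℓ j = b → Single φ j → col φ j ≠ col φ' j) := by
  rw [key_eq_iff] at h
  obtain ⟨h1, h2⟩ := h
  by_contra hcon
  push Not at hcon
  obtain ⟨⟨j₁, hl₁, hs₁, hc₁⟩, ⟨j₂, hl₂, hs₂, hc₂⟩⟩ := hcon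
  have hne : j₁ ≠ j₂ := by rintro rfl; exact hc₁ hc₂
  have key := h2 j₁ j₂ ((h1 _).1 hs₁) ((h1 _).1 hs₂) hne (hl₁.trans hl₂.symm)
  revert key hc₁ hc₂
  cases col φ j₁ <;> cases col φ j₂ <;> cases col φ' j₁ <;> cases col φ' j₂ <;> simp

omit [Fintype J] in
/-- Same key, colours agreeing on the singles of label `b`: same single slots of each colour. [folklore] -/
private theorem slotsSC_eq_of_agree [Fintype J] {n n' : ℕ} {φ : Fin n → J × Bool} {φ' : Fin n' → J × Bool}
    (h : key ℓ φ = key ℓ φ') {b : L} (hb : ∀ j, ℓ j = b → Single φ j → col φ j = col φ' j)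
    (c : Bool) : slotsSC ℓ φ' b c = slotsSC ℓ φ b c := by
  have h1 := ((key_eq_iff φ φ').1 h).1
  ext j
  simp only [slotsSC, Finset.mem_filter, Finset.mem_univ, true_and]
  constructor
  · rintro ⟨hl, hs, hc⟩
    exact ⟨hl, (h1 j).2 hs, by rw [hb j hl ((h1 j).2 hs), hc]⟩
  · rintro ⟨hl, hs, hc⟩
    exact ⟨hl, (h1 j).1 hs, by rw [← hb j hl hs, hc]⟩

omit [Fintype J] in
/-- Same key, colours opposite on the singles of label `b`: the single slots of the two colours are
exchanged. [folklore] -/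
private theorem slotsSC_eq_of_disagree [Fintype J] {n n' : ℕ} {φ : Fin n → J × Bool} {φ' : Fin n' → J × Bool}
    (h : key ℓ φ = key ℓ φ') {b : L} (hb : ∀ j, ℓ j = b → Single φ j → col φ j ≠ col φ' j)
    (c : Bool) : slotsSC ℓ φ' b c = slotsSC ℓ φ b (!c) := by
  have h1 := ((key_eq_iff φ φ').1 h).1
  ext j
  simp only [slotsSC, Finset.mem_filter, Finset.mem_univ, true_and]
  constructor
  · rintro ⟨hl, hs, hc⟩
    refine ⟨hl, (h1 j).2 hs, ?_⟩
    have := hb j hl ((h1 j).2 hs)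
    revert this hc; cases col φ j <;> cases col φ' j <;> cases c <;> simp
  · rintro ⟨hl, hs, hc⟩
    refine ⟨hl, (h1 j).1 hs, ?_⟩
    have := hb j hl hs
    revert this hc; cases col φ j <;> cases col φ' j <;> cases c <;> simp

omit [Fintype J] in
/-- **Balance is a key invariant** (among injective words). [folklore] -/
private theorem balanced_iff_of_key_eq [Fintype J] {n n' : ℕ} {φ : Fin n → J × Bool} {φ' : Fin n' → J × Bool}
    (hφ : Function.Injective φ) (hφ' : Function.Injective φ') (h : key ℓ φ = key ℓ φ') :
    Balanced ℓ φ ↔ Balanced ℓ φ' := by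
  rw [balanced_iff_of_injective hφ, balanced_iff_of_injective hφ']
  refine forall_congr' fun b ↦ ?_
  rcases col_agree_or_disagree h b with hb | hb
  · rw [slotsSC_eq_of_agree h hb, slotsSC_eq_of_agree h hb]
  · rw [slotsSC_eq_of_disagree h hb, slotsSC_eq_of_disagree h hb]
    simp only [Bool.not_true, Bool.not_false]
    exact eq_comm

/-! #### Signs of singly occupied slots; the `(p,p)` constraint as a vanishing sum of signs -/

/-- The SIGN of slot `j` in the word `φ`: `+1` if `x_j` occurs, `-1` otherwise (so on a singly
occupied slot `T_j^*` acts on `m_φ` by `sgn · μ`). [folklore] -/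
private def sgn {n : ℕ} (φ : Fin n → J × Bool) (j : J) : ℂ := if col φ j then 1 else -1

omit [Fintype J] [DecidableEq L] in
/-- `sgn² = 1`. [folklore] -/
private theorem sgn_mul_self {n : ℕ} (φ : Fin n → J × Bool) (j : J) : sgn φ j * sgn φ j = 1 := by
  unfold sgn; split_ifs <;> norm_num

omit [Fintype J] [DecidableEq L] in
/-- On a singly occupied slot of an injective word, the symbol of `T_j^*` is `sgn · μ`. [folklore] -/
private theorem prod_slotEv_eq_sgn_mul {n : ℕ} {φ : Fin n → J × Bool} (hφ : Function.Injective φ) {j : J}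
    (hj : Single φ j) : (∏ i, slotEv μ ℓ j (φ i)) = sgn φ j * μ (ℓ j) := by
  rw [prod_slotEv_eq_of_single hφ hj]
  unfold sgn
  split_ifs <;> ring

omit [Fintype J] in
/-- **Within a key, the product of the signs of two singly occupied slots of the same label is
constant** (the key records the colour agreement of such pairs). [folklore] -/
private theorem sgn_mul_sgn_eq_of_key_eq [Fintype J] {n n' : ℕ} {φ : Fin n → J × Bool}
    {φ' : Fin n' → J × Bool} (h : key ℓ φ = key ℓ φ') {j₀ j : J} (hj₀ : Single φ' j₀)
    (hj : Single φ' j) (hl : ℓ j₀ = ℓ j) : sgn φ j₀ * sgn φ j = sgn φ' j₀ * sgn φ' j := by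
  by_cases hne : j₀ = j
  · subst hne
    rw [sgn_mul_self, sgn_mul_self]
  · have hiff := ((key_eq_iff φ φ').1 h).2 j₀ j hj₀ hj hne hl
    unfold sgn
    revert hiff
    cases col φ j₀ <;> cases col φ j <;> cases col φ' j₀ <;> cases col φ' j <;> simp

/-- The singly occupied slots of label `l` split by colour, and the signs add up to
`#(colour tt) - #(colour ff)`. [folklore] -/
private theorem sum_sgn_filter_label {n : ℕ} (φ : Fin n → J × Bool) (l : L) :
    ∑ j ∈ Finset.univ.filter (fun j ↦ Single φ j ∧ ℓ j = l), sgn φ j =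
      ((slotsSC ℓ φ l true).card : ℂ) - (slotsSC ℓ φ l false).card := by
  classical
  have hsplit : Finset.univ.filter (fun j ↦ Single φ j ∧ ℓ j = l) =
      slotsSC ℓ φ l true ∪ slotsSC ℓ φ l false := by
    ext j
    simp only [slotsSC, Finset.mem_filter, Finset.mem_univ, true_and, Finset.mem_union]
    cases col φ j <;> simp [and_comm]
  have hdisj : Disjoint (slotsSC ℓ φ l true) (slotsSC ℓ φ l false) := by
    rw [Finset.disjoint_left]
    intro j h1 h2
    simp only [slotsSC, Finset.mem_filter, Finset.mem_univ, true_and] at h1 h2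
    have := h1.2.2.symm.trans h2.2.2
    exact Bool.noConfusion this
  have h1 : ∀ j ∈ slotsSC ℓ φ l true, sgn φ j = 1 := by
    intro j hj
    simp only [slotsSC, Finset.mem_filter, Finset.mem_univ, true_and] at hj
    simp [sgn, hj.2.2]
  have h2 : ∀ j ∈ slotsSC ℓ φ l false, sgn φ j = -1 := by
    intro j hj
    simp only [slotsSC, Finset.mem_filter, Finset.mem_univ, true_and] at hj
    simp [sgn, hj.2.2]
  rw [hsplit, Finset.sum_union hdisj, Finset.sum_congr rfl h1, Finset.sum_congr rfl h2,
    Finset.sum_const, Finset.sum_const]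
  simp [sub_eq_add_neg]

include ℓ in
/-- **The `(p,p)` constraint**: an injective word with as many `tt`- as `ff`-letters has as many
`tt`- as `ff`-coloured singly occupied slots, i.e. `∑_{j single} sgn_j = 0` (doubly occupied slots
carry one letter of each colour). [folklore] -/
private theorem sum_sgn_eq_zero [Fintype L] {n : ℕ} {φ : Fin n → J × Bool} (hφ : Function.Injective φ)
    (hpp : cntC φ true = cntC φ false) :
    ∑ j ∈ Finset.univ.filter (fun j ↦ Single φ j), sgn φ j = 0 := by
  classical
  rw [← Finset.sum_fiberwise (Finset.univ.filter fun j ↦ Single φ j) ℓ (fun j ↦ sgn φ j)]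
  have hinner : ∀ l, ∑ j ∈ (Finset.univ.filter fun j ↦ Single φ j).filter (fun j ↦ ℓ j = l), sgn φ j =
      ((slotsSC ℓ φ l true).card : ℂ) - (slotsSC ℓ φ l false).card := by
    intro l
    rw [Finset.filter_filter]
    exact sum_sgn_filter_label φ l
  rw [Finset.sum_congr rfl fun l _ ↦ hinner l, Finset.sum_sub_distrib]
  have hT : ((cntC φ true : ℕ) : ℂ) =
      ∑ l, ((slotsSC ℓ φ l true).card : ℂ) + ∑ l, ((slotsD ℓ φ l).card : ℂ) := by
    rw [cntC_eq_sum (ℓ := ℓ), ← Finset.sum_add_distrib]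
    push_cast
    exact Finset.sum_congr rfl fun l _ ↦ by rw [cntLC_eq_card_of_injective hφ]; push_cast; rfl
  have hF : ((cntC φ false : ℕ) : ℂ) =
      ∑ l, ((slotsSC ℓ φ l false).card : ℂ) + ∑ l, ((slotsD ℓ φ l).card : ℂ) := by
    rw [cntC_eq_sum (ℓ := ℓ), ← Finset.sum_add_distrib]
    push_cast
    exact Finset.sum_congr rfl fun l _ ↦ by rw [cntLC_eq_card_of_injective hφ]; push_cast; rfl
  have h : ((cntC φ true : ℕ) : ℂ) = ((cntC φ false : ℕ) : ℂ) := by rw [hpp]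
  rw [hT, hF] at h
  linear_combination h

/-! #### Unbalanced keys carry no rational `(p,p)`-class (trace argument) -/

omit [Fintype J] [DecidableEq J] [DecidableEq L] in
/-- `μ ≠ 0` (as `μ² = -d ≠ 0`). [folklore] -/
private theorem mu_ne_zero {d : L → ℕ} (hd : ∀ b, 0 < d b) (hμ2 : ∀ b, μ b ^ 2 = -(d b : ℂ)) (b : L) :
    μ b ≠ 0 := by
  intro h
  have := hμ2 b
  rw [h, zero_pow two_ne_zero, eq_comm, neg_eq_zero, Nat.cast_eq_zero] at this
  exact (hd b).ne' this

/-- **An UNBALANCED key carries no non-zero rational `(p,p)`-class.** Let `φ₁` be an injective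
word, unbalanced at the label `l₀`, and `v` a RATIONAL class in the span `V` of the monomials
of the injective `(p,p)`-words of its key. Let `U ⊆ V` be the span of the rational classes of `V`
(stable under the slot operators). For single slots `j₀` (label `l₀`) and `j`, the operator
`C_j = T_{j₀}^* T_j^*` acts on `m_φ` by `sgn_{j₀} sgn_j μ_{l₀} μ_{ℓ j}`; (i) for `ℓ j = l₀` the product
`sgn_{j₀} sgn_j` is constant on the key, so `C_j = ± μ_{l₀}² · id` on `V`; (ii) for `ℓ j ≠ l₀`,
`C_j² = μ_{l₀}² μ_{ℓ j}²` on `V`, so `tr(C_j|_U) ∈ μ_{l₀} μ_{ℓ j} · ℤ` (`exists_int_trace_of_mul_self_eq`)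
and `tr(C_j|_U) ∈ ℚ` (`exists_rat_trace_restrict`), whence `tr(C_j|_U) = 0` as `± μ_{l₀} μ_{ℓ j}`
is irrational (`d_{l₀} d_{ℓ j}` not a square); (iii) `N = ∑_{j single} μ_{ℓ j}⁻¹ C_j` acts on `m_φ`
by `sgn_{j₀} μ_{l₀} ∑_j sgn_j = 0` (the `(p,p)` constraint), so `0 = tr(N|_U) = ± μ_{l₀} · dim U ·
(#tt-singles − #ff-singles of label l₀)`, and the last factor is non-zero: `dim U = 0`, `v = 0`.
This replaces the Galois-theoretic step "`Hg = ∏ U(1)` and no weight vanishes" of the printed proofs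
(Imai; Moonen–Zarhin Cor. (3.9)); only PAIRS of labels enter, so pairwise distinct CM fields suffice.
[cite: MoonenZarhin1999LowDim, §3 Cor. (3.9)] [cite: vanGeemen1994HodgeAV, Thm. 4.3] -/
private theorem eq_zero_of_unbalanced [Fintype L]
    (hμω : ∀ b, complexBetti.map (ψ b).hom.hom.hom 1 (ω b) = μ b • ω b)
    (hμc : ∀ b, starRingEnd ℂ (μ b) = -μ b)
    (hTg : ∀ j, T j ≫ g j = g j ≫ ψ (ℓ j)) (hTg' : ∀ j i, i ≠ j → T j ≫ g i = g i)
    {d : L → ℕ} (hd : ∀ b, 0 < d b) (hμ2 : ∀ b, μ b ^ 2 = -(d b : ℂ))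
    (hsq : ∀ l l', l ≠ l' → ¬ IsSquare (d l * d l'))
    {p : ℕ} {φ₁ : Fin (2 * p) → J × Bool} (hφ₁ : Function.Injective φ₁)
    (hbal : ¬ Balanced ℓ φ₁) {v : complexBetti B.X (2 * p)} (hvrat : IsRationalClass v)
    (hv : v ∈ Submodule.span ℂ (mono ω g (2 * p) ''
      {φ | Function.Injective φ ∧ key ℓ φ = key ℓ φ₁ ∧ cntC φ true = p})) : v = 0 := by
  classical
  haveI : Module.Finite ℂ (complexBetti B.X (2 * p)) := finite_complexBetti_abelianVariety B (2 * p)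
  set S : Set (Fin (2 * p) → J × Bool) :=
    {φ | Function.Injective φ ∧ key ℓ φ = key ℓ φ₁ ∧ cntC φ true = p} with hS
  set V : Submodule ℂ (complexBetti B.X (2 * p)) := Submodule.span ℂ (mono ω g (2 * p) '' S) with hV
  -- an unbalanced label `l₀` and a single slot `j₀` of that label
  rw [balanced_iff_of_injective hφ₁] at hbal
  push Not at hbal
  obtain ⟨l₀, hl₀⟩ := hbal
  have hne : (slotsSC ℓ φ₁ l₀ true ∪ slotsSC ℓ φ₁ l₀ false).Nonempty := by
    by_contra h
    rw [Finset.not_nonempty_iff_eq_empty, Finset.union_eq_empty] at h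
    apply hl₀
    rw [h.1, h.2]
  obtain ⟨j₀, hj₀mem⟩ := hne
  have hj₀ : Single φ₁ j₀ ∧ ℓ j₀ = l₀ := by
    rcases Finset.mem_union.1 hj₀mem with h | h <;>
      simp only [slotsSC, Finset.mem_filter, Finset.mem_univ, true_and] at h <;> exact ⟨h.2.1, h.1⟩
  -- members of `S`: single slots and the `(p,p)` count
  have hSingle : ∀ φ ∈ S, ∀ j, Single φ₁ j → Single φ j :=
    fun φ hφ j hj ↦ (((key_eq_iff φ φ₁).1 hφ.2.1).1 j).2 hj
  have hppS : ∀ φ ∈ S, cntC φ true = cntC φ false := by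
    intro φ hφ
    have := cntC_true_add_cntC_false φ
    rw [hφ.2.2] at this ⊢
    omega
  -- the composite `C_j = T_{j₀}^* T_j^*` on the monomials of `S`
  have hC : ∀ j, Single φ₁ j → ∀ φ ∈ S,
      (slotOp T j₀ (2 * p) * slotOp T j (2 * p)) (mono ω g (2 * p) φ) =
        ((sgn φ j₀ * μ (ℓ j₀)) * (sgn φ j * μ (ℓ j))) • mono ω g (2 * p) φ := by
    intro j hj φ hφ
    rw [Module.End.mul_apply, slotOp_mono hμω hμc hTg hTg' j φ,
      prod_slotEv_eq_sgn_mul hφ.1 (hSingle φ hφ j hj), map_smul, slotOp_mono hμω hμc hTg hTg' j₀ φ,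
      prod_slotEv_eq_sgn_mul hφ.1 (hSingle φ hφ j₀ hj₀.1), smul_smul,
      mul_comm (sgn φ j * μ (ℓ j)) (sgn φ j₀ * μ (ℓ j₀))]
  -- transfer: an operator acting by a CONSTANT scalar on the monomials of `S` acts so on `V`
  have hscal : ∀ (G : Module.End ℂ (complexBetti B.X (2 * p))) (c₀ : ℂ),
      (∀ φ ∈ S, G (mono ω g (2 * p) φ) = c₀ • mono ω g (2 * p) φ) → ∀ x ∈ V, G x = c₀ • x := by
    intro G c₀ hG x hx
    have hle : V ≤ LinearMap.ker (G - c₀ • 1) := by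
      rw [hV]
      refine Submodule.span_le.2 ?_
      rintro _ ⟨φ, hφ, rfl⟩
      rw [SetLike.mem_coe, LinearMap.mem_ker, LinearMap.sub_apply, hG φ hφ, LinearMap.smul_apply,
        Module.End.one_apply, sub_self]
    have h := hle hx
    rwa [LinearMap.mem_ker, LinearMap.sub_apply, LinearMap.smul_apply, Module.End.one_apply,
      sub_eq_zero] at h
  -- `V` is stable under the slot operators
  have hVstab : ∀ j, ∀ x ∈ V, slotOp T j (2 * p) x ∈ V := by
    intro j x hx
    have h := (goodOp_slotOp hμω hμc hTg hTg' j (2 * p) p).apply_mem_span S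
      (show x ∈ Submodule.span ℂ (mono ω g (2 * p) '' S) from hx)
    exact Submodule.span_mono (Set.image_mono fun φ hφ ↦ hφ.1) h
  -- `U` := the span of the rational classes of `V`
  set U : Submodule ℂ (complexBetti B.X (2 * p)) :=
    Submodule.span ℂ {u | u ∈ V ∧ IsRationalClass u} with hU
  have hUV : U ≤ V := Submodule.span_le.2 fun u hu ↦ hu.1
  have hvU : v ∈ U := Submodule.subset_span ⟨hv, hvrat⟩
  have hUrat : Submodule.span ℂ {u : U | IsRationalClass (u : complexBetti B.X (2 * p))} = ⊤ := by
    rw [eq_top_iff, ← Submodule.span_span_coe_preimage]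
    exact Submodule.span_mono fun u hu ↦ hu.2
  have hUstab : ∀ j, ∀ x ∈ U, slotOp T j (2 * p) x ∈ U := by
    intro j x hx
    induction hx using Submodule.span_induction with
    | mem u hu => exact Submodule.subset_span ⟨hVstab j u hu.1, hu.2.map _⟩
    | zero => rw [map_zero]; exact Submodule.zero_mem _
    | add x y _ _ hx hy => rw [map_add]; exact Submodule.add_mem _ hx hy
    | smul a x _ hx => rw [map_smul]; exact Submodule.smul_mem _ _ hx
  have hCstab : ∀ j, ∀ x ∈ U, (slotOp T j₀ (2 * p) * slotOp T j (2 * p)) x ∈ U :=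
    fun j x hx ↦ by rw [Module.End.mul_apply]; exact hUstab j₀ _ (hUstab j x hx)
  have hCrat : ∀ j (x : complexBetti B.X (2 * p)), IsRationalClass x →
      IsRationalClass ((slotOp T j₀ (2 * p) * slotOp T j (2 * p)) x) :=
    fun j x hx ↦ by rw [Module.End.mul_apply]; exact (hx.map _).map _
  -- the restricted operators `f j = C_j|_U`
  set f : J → Module.End ℂ U := fun j ↦ (slotOp T j₀ (2 * p) * slotOp T j (2 * p)).restrict (hCstab j)
    with hf
  have hf_apply : ∀ j (x : U), ((f j x : U) : complexBetti B.X (2 * p)) =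
      (slotOp T j₀ (2 * p) * slotOp T j (2 * p)) x := fun j x ↦ rfl
  -- (i) same label: `f j` is the scalar `sgn φ₁ j₀ · sgn φ₁ j · μ_{l₀}²`
  have hsame : ∀ j, Single φ₁ j → ℓ j = ℓ j₀ →
      f j = (sgn φ₁ j₀ * sgn φ₁ j * μ (ℓ j₀) ^ 2) • LinearMap.id := by
    intro j hj hl
    have hact : ∀ φ ∈ S, (slotOp T j₀ (2 * p) * slotOp T j (2 * p)) (mono ω g (2 * p) φ) =
        (sgn φ₁ j₀ * sgn φ₁ j * μ (ℓ j₀) ^ 2) • mono ω g (2 * p) φ := by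
      intro φ hφ
      rw [hC j hj φ hφ, hl]
      congr 1
      have hs := sgn_mul_sgn_eq_of_key_eq hφ.2.1 hj₀.1 hj hl.symm
      linear_combination (μ (ℓ j₀)) ^ 2 * hs
    apply LinearMap.ext
    intro x
    apply Subtype.ext
    rw [hf_apply, LinearMap.smul_apply, LinearMap.id_apply, Submodule.coe_smul]
    exact hscal _ _ hact x (hUV x.2)
  -- (ii) different labels: the trace of `f j` vanishes
  have hcross : ∀ j, Single φ₁ j → ℓ j ≠ ℓ j₀ → LinearMap.trace ℂ U (f j) = 0 := by
    intro j hj hl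
    set s : ℂ := μ (ℓ j₀) * μ (ℓ j) with hs
    have hs0 : s ≠ 0 := mul_ne_zero (mu_ne_zero hd hμ2 _) (mu_ne_zero hd hμ2 _)
    have hff : f j * f j = (s ^ 2) • 1 := by
      have hact : ∀ φ ∈ S, ((slotOp T j₀ (2 * p) * slotOp T j (2 * p)) *
          (slotOp T j₀ (2 * p) * slotOp T j (2 * p))) (mono ω g (2 * p) φ) = (s ^ 2) • mono ω g (2 * p) φ := by
        intro φ hφ
        rw [Module.End.mul_apply, hC j hj φ hφ, map_smul, hC j hj φ hφ, smul_smul]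
        congr 1
        have h1 := sgn_mul_self φ j₀
        have h2 := sgn_mul_self φ j
        rw [hs]
        linear_combination (sgn φ j * sgn φ j * (μ (ℓ j₀)) ^ 2 * (μ (ℓ j)) ^ 2) * h1 +
          ((μ (ℓ j₀)) ^ 2 * (μ (ℓ j)) ^ 2) * h2
      apply LinearMap.ext
      intro x
      apply Subtype.ext
      rw [Module.End.mul_apply, hf_apply, hf_apply, LinearMap.smul_apply, Module.End.one_apply,
        Submodule.coe_smul, ← Module.End.mul_apply]
      exact hscal _ _ hact x (hUV x.2)
    obtain ⟨m, hm⟩ := exists_int_trace_of_mul_self_eq (f j) rfl hs0 hff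
    obtain ⟨q, hq⟩ := exists_rat_trace_restrict hUrat (hCrat j) (hCstab j)
    by_contra hne0
    have hm0 : m ≠ 0 := by
      rintro rfl
      rw [Int.cast_zero, zero_mul] at hm
      exact hne0 hm
    have hm0C : (m : ℂ) ≠ 0 := by exact_mod_cast hm0
    have key := mul_ne_ratCast_of_not_isSquare (hμ2 (ℓ j₀)) (hμ2 (ℓ j)) (hsq _ _ (Ne.symm hl)) 1
      (Or.inl rfl) (q / m)
    apply key
    rw [one_mul, Rat.cast_div, Rat.cast_intCast, ← hq, hm, hs]
    field_simp
  -- (iii) the vanishing combination `N = ∑_{j single} μ_{ℓ j}⁻¹ • C_j`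
  set D₁ : Finset J := Finset.univ.filter fun j ↦ Single φ₁ j with hD₁
  have hmemD₁ : ∀ j, j ∈ D₁ ↔ Single φ₁ j := fun j ↦ by simp [hD₁]
  have hN : ∀ φ ∈ S, (∑ j ∈ D₁, (μ (ℓ j))⁻¹ • (slotOp T j₀ (2 * p) * slotOp T j (2 * p)))
      (mono ω g (2 * p) φ) = (0 : ℂ) • mono ω g (2 * p) φ := by
    intro φ hφ
    rw [LinearMap.sum_apply]
    have hterm : ∀ j ∈ D₁, ((μ (ℓ j))⁻¹ • (slotOp T j₀ (2 * p) * slotOp T j (2 * p)))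
        (mono ω g (2 * p) φ) = (sgn φ j₀ * μ (ℓ j₀) * sgn φ j) • mono ω g (2 * p) φ := by
      intro j hjD
      rw [LinearMap.smul_apply, hC j ((hmemD₁ j).1 hjD) φ hφ, smul_smul]
      congr 1
      field_simp [mu_ne_zero hd hμ2 (ℓ j)]
    rw [Finset.sum_congr rfl hterm, ← Finset.sum_smul, ← Finset.mul_sum]
    have hD : D₁ = Finset.univ.filter fun j ↦ Single φ j := by
      ext j
      rw [hmemD₁, Finset.mem_filter]
      simpa using (((key_eq_iff φ φ₁).1 hφ.2.1).1 j).symm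
    rw [hD, sum_sgn_eq_zero (ℓ := ℓ) hφ.1 (hppS φ hφ), mul_zero]
  have hsumf : ∑ j ∈ D₁, (μ (ℓ j))⁻¹ • f j = 0 := by
    apply LinearMap.ext
    intro x
    apply Subtype.ext
    have hx := hscal _ _ hN x (hUV x.2)
    rw [zero_smul, LinearMap.sum_apply] at hx
    rw [LinearMap.sum_apply, LinearMap.zero_apply, Submodule.coe_sum, Submodule.coe_zero, ← hx]
    refine Finset.sum_congr rfl fun j _ ↦ ?_
    rw [LinearMap.smul_apply, LinearMap.smul_apply, Submodule.coe_smul, hf_apply]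
  -- (iv) traces
  have htr := congrArg (LinearMap.trace ℂ U) hsumf
  rw [map_sum, map_zero, ← Finset.sum_filter_add_sum_filter_not D₁ (fun j ↦ ℓ j = ℓ j₀)] at htr
  have hA : ∑ j ∈ D₁.filter (fun j ↦ ℓ j = ℓ j₀), LinearMap.trace ℂ U ((μ (ℓ j))⁻¹ • f j) =
      ((μ (ℓ j₀))⁻¹ * (sgn φ₁ j₀ * μ (ℓ j₀) ^ 2 * (Module.finrank ℂ U : ℂ))) *
        ∑ j ∈ D₁.filter (fun j ↦ ℓ j = ℓ j₀), sgn φ₁ j := by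
    rw [Finset.mul_sum]
    refine Finset.sum_congr rfl fun j hj ↦ ?_
    rw [Finset.mem_filter] at hj
    rw [map_smul, hsame j ((hmemD₁ j).1 hj.1) hj.2, map_smul, LinearMap.trace_id, hj.2, smul_eq_mul,
      smul_eq_mul]
    ring
  have hB : ∑ j ∈ D₁.filter (fun j ↦ ¬ ℓ j = ℓ j₀), LinearMap.trace ℂ U ((μ (ℓ j))⁻¹ • f j) = 0 := by
    refine Finset.sum_eq_zero fun j hj ↦ ?_
    rw [Finset.mem_filter] at hj
    rw [map_smul, hcross j ((hmemD₁ j).1 hj.1) hj.2, smul_zero]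
  have hsgn : ∑ j ∈ D₁.filter (fun j ↦ ℓ j = ℓ j₀), sgn φ₁ j =
      ((slotsSC ℓ φ₁ l₀ true).card : ℂ) - (slotsSC ℓ φ₁ l₀ false).card := by
    rw [hD₁, Finset.filter_filter, hj₀.2]
    exact sum_sgn_filter_label φ₁ l₀
  rw [hA, hB, add_zero, hsgn] at htr
  -- the factors other than `finrank U` are non-zero
  have hμ0 : μ (ℓ j₀) ≠ 0 := mu_ne_zero hd hμ2 _
  have hsgn0 : sgn φ₁ j₀ ≠ 0 := by unfold sgn; split_ifs <;> norm_num
  have hTF : ((slotsSC ℓ φ₁ l₀ true).card : ℂ) - (slotsSC ℓ φ₁ l₀ false).card ≠ 0 := by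
    intro h
    apply hl₀
    exact_mod_cast (sub_eq_zero.1 h)
  have hdim : (Module.finrank ℂ U : ℂ) = 0 := by
    have h := mul_eq_zero.1 htr
    rcases h with h | h
    · rcases mul_eq_zero.1 h with h | h
      · exact absurd h (inv_ne_zero hμ0)
      · rcases mul_eq_zero.1 h with h | h
        · rcases mul_eq_zero.1 h with h | h
          · exact absurd h hsgn0
          · exact absurd h (pow_ne_zero 2 hμ0)
        · exact h
    · exact absurd h hTF
  have hU0 : U = ⊥ := Submodule.finrank_eq_zero.1 (by exact_mod_cast hdim)
  rw [hU0, Submodule.mem_bot] at hvU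
  exact hvU

/-! #### The Hodge type of a monomial -/

omit [Fintype J] [DecidableEq J] [DecidableEq L] in
/-- **`m_φ` is of Hodge type `(# tt, # ff)`** (cup products add types). [cite: VoisinHodgeI2002, §7.1.2] -/
private theorem isOfHodgeType_mono (hω : ∀ b, IsOfHodgeType (E b).dim (E b).X 1 1 0 (ω b)) {n : ℕ} (hn : 0 < n)
    (φ : Fin n → J × Bool) : IsOfHodgeType B.dim B.X n (cntC φ true) (cntC φ false) (mono ω g n φ) := by
  have hBs : IsSmoothProjective B.dim B.X := Motives.AbelianVariety.isSmoothProjective_holds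
  have h := isOfHodgeType_cupPowOne hBs hn (colGen ω g ∘ φ) (fun i ↦ if (φ i).2 then 1 else 0)
    (fun i ↦ if (φ i).2 then 0 else 1) (fun i ↦ isOfHodgeType_colGen hω (φ i))
  have e1 : (∑ i, if (φ i).2 then 1 else 0) = cntC φ true := by
    unfold cntC; exact Finset.sum_congr rfl fun i _ ↦ by cases (φ i).2 <;> rfl
  have e2 : (∑ i, if (φ i).2 then 0 else 1) = cntC φ false := by
    unfold cntC; exact Finset.sum_congr rfl fun i _ ↦ by cases (φ i).2 <;> rfl
  rw [e1, e2] at h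
  exact h

/-! #### Balanced monomials lie in `Dᵖ ⊗ ℂ` -/

omit [Fintype J] [DecidableEq J] [DecidableEq L] in
/-- Transport of a slot projection along an equality of labels. [folklore] -/
private theorem exists_map_eq_of_label_eq {b b' : L} (h : b' = b) (f : B ⟶ E b') :
    ∃ f' : B ⟶ E b, ∀ w : ∀ b, complexBetti (E b).X 1,
      complexBetti.map f.hom.hom.hom 1 (w b') = complexBetti.map f'.hom.hom.hom 1 (w b) := by
  subst h; exact ⟨f, fun _ ↦ rfl⟩

omit [Fintype J] [DecidableEq J] [DecidableEq L] in
/-- **The cross classes `x_j ⌣ x̄_{j'}` with `ℓ j = ℓ j'` are divisor classes**: pull back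
`pr₁^*ω ⌣ pr₂^*ω̄ ∈ D¹(E × E) ⊗ ℂ` (`EllipticCurve.cm_cross_mem_span_rational_oneOne`, where complex
multiplication is used) along `(g_j, g_{j'}) : B → E × E`. [cite: Gordon1997, §3 (Murasaki [B.80])]
[cite: LangeBirkenhake1992, §5] -/
private theorem cross_mem_span_rational_oneOne {d : L → ℕ} (hE : ∀ b, (E b).dim = 1) (hd : ∀ b, 0 < d b)
    (hψ : ∀ b, ψ b ≫ ψ b = -(d b • 𝟙 (E b))) (hω : ∀ b, IsOfHodgeType (E b).dim (E b).X 1 1 0 (ω b))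
    (hω0 : ∀ b, ω b ≠ 0)
    (hωgen : ∀ b (u : complexBetti (E b).X 1), IsOfHodgeType (E b).dim (E b).X 1 1 0 u → ∃ c : ℂ, u = c • ω b)
    (j j' : J) (hl : ℓ j = ℓ j') :
    cupProduct (show 1 + 1 = 2 by norm_num) (colGen ω g (j, true)) (colGen ω g (j', false)) ∈
      Submodule.span ℂ {b : complexBetti B.X 2 | IsRationalClass b ∧ IsOfHodgeType B.dim B.X 2 1 1 b} := by
  have h11 : (1 : ℕ) + 1 = 2 := by norm_num
  have hBs : IsSmoothProjective B.dim B.X := Motives.AbelianVariety.isSmoothProjective_holds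
  set b := ℓ j with hb
  have hEEs : IsSmoothProjective ((E b).prod (E b)).dim ((E b).prod (E b)).X :=
    Motives.AbelianVariety.isSmoothProjective_holds
  obtain ⟨f', hf'⟩ := exists_map_eq_of_label_eq (E := E) (B := B) hl.symm (g j')
  obtain ⟨hcross, -⟩ := EllipticCurve.cm_cross_mem_span_rational_oneOne (hE b) (ψ b) (hd b) (hψ b)
    (hω b) (hω0 b) (hωgen b)
  have hgh := map_mem_span_rational_oneOne hBs hEEs (Motives.AbelianVariety.prodLift (g j) f').hom.hom.hom hcross
  rw [complexBetti.map_cupProduct, complexBetti_map_map_hom, complexBetti_map_map_hom,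
    Motives.AbelianVariety.prodLift_fst, Motives.AbelianVariety.prodLift_snd] at hgh
  have e1 : colGen ω g (j, true) = complexBetti.map (g j).hom.hom.hom 1 (ω b) := rfl
  have e2 : colGen ω g (j', false) =
      complexBetti.map f'.hom.hom.hom 1 (conjClass (Motives.ComplexPoints (E b).X) 1 (ω b)) := by
    change conjClass _ 1 (complexBetti.map (g j').hom.hom.hom 1 (ω (ℓ j'))) = _
    rw [conjClass_map]
    exact hf' fun b ↦ conjClass (Motives.ComplexPoints (E b).X) 1 (ω b)
  rw [e1, e2]
  exact hgh

omit [Fintype J] [DecidableEq J] in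
/-- **A balanced monomial lies in `Dᵐ ⊗ ℂ`**: reorder (two transpositions, a sign) so that the first
two letters are `x_j`, `x̄_{j'}` with `ℓ j = ℓ j'`; then `x_j ⌣ (x̄_{j'} ⌣ M) = M ⌣ (x_j ⌣ x̄_{j'})`
with `x_j ⌣ x̄_{j'} ∈ D¹ ⊗ ℂ` and `M` balanced of lower degree. (The labelled refinement of
`cupPowOne_mem_divisorClassesSpan_of_balanced`.) [cite: Gordon1997, §3 (proof of the Theorem)]
[cite: LangeBirkenhake1992, Lemma 1.1.17 and Thm. 4.2.1] -/
private theorem mono_mem_divisorClassesSpan_of_balanced [Fintype L] {d : L → ℕ} (hE : ∀ b, (E b).dim = 1)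
    (hd : ∀ b, 0 < d b) (hψ : ∀ b, ψ b ≫ ψ b = -(d b • 𝟙 (E b)))
    (hω : ∀ b, IsOfHodgeType (E b).dim (E b).X 1 1 0 (ω b)) (hω0 : ∀ b, ω b ≠ 0)
    (hωgen : ∀ b (u : complexBetti (E b).X 1), IsOfHodgeType (E b).dim (E b).X 1 1 0 u → ∃ c : ℂ, u = c • ω b) :
    ∀ (m : ℕ) (φ : Fin (2 * m) → J × Bool), Balanced ℓ φ →
      mono ω g (2 * m) φ ∈ divisorClassesSpan B.X B.dim m := by
  intro m
  induction m with
  | zero =>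
    intro φ _
    change cupPowOne ℂ (Motives.ComplexPoints B.X) 0 (colGen ω g ∘ φ) ∈ divisorClassesSpan B.X B.dim 0
    rw [cupPowOne_zero]
    exact Submodule.subset_span (mem_divisorMonomials_zero.2 rfl)
  | succ m ih =>
    intro φ hφ
    haveI : NeZero (2 * (m + 1)) := ⟨by omega⟩
    -- total counts: `# tt = # ff = m + 1`
    have htt : cntC φ true = m + 1 := by
      have h1 := cntC_true_add_cntC_false φ
      have h2 : cntC φ true = cntC φ false := cntC_eq_of_balanced hφ
      omega
    -- Step 1: a letter of colour `tt`, moved to position `0`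
    obtain ⟨i₀, -, hi₀⟩ := Finset.exists_ne_zero_of_sum_ne_zero
      (show (∑ i, if (φ i).2 = true then 1 else 0) ≠ 0 by
        change cntC φ true ≠ 0; rw [htt]; exact Nat.succ_ne_zero m)
    have hc₀ : (φ i₀).2 = true := by by_contra h; exact hi₀ (if_neg h)
    let σ₁ : Equiv.Perm (Fin (2 * (m + 1))) := Equiv.swap 0 i₀
    let φ₁ : Fin (2 * (m + 1)) → J × Bool := φ ∘ σ₁
    have hφ₁0 : φ₁ 0 = φ i₀ := by change φ (Equiv.swap 0 i₀ 0) = φ i₀; rw [Equiv.swap_apply_left]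
    have hbal₁ : Balanced ℓ φ₁ := fun b ↦ by
      change cntLC ℓ (φ ∘ σ₁) b true = cntLC ℓ (φ ∘ σ₁) b false
      rw [cntLC_comp_perm φ σ₁, cntLC_comp_perm φ σ₁]; exact hφ b
    set b₀ := ℓ (φ i₀).1 with hb₀
    -- Step 2: a letter of label `b₀` and colour `ff`, at an index `i₁ ≠ 0`, moved to position `1`
    have hff : cntLC ℓ φ₁ b₀ false ≠ 0 := by
      rw [← hbal₁ b₀]
      unfold cntLC
      intro h0
      have := (Finset.sum_eq_zero_iff.1 h0) 0 (Finset.mem_univ _)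
      rw [hφ₁0, if_pos ⟨hb₀.symm, hc₀⟩] at this
      exact one_ne_zero this
    obtain ⟨i₁, -, hi₁⟩ := Finset.exists_ne_zero_of_sum_ne_zero hff
    have hP₁ : ℓ (φ₁ i₁).1 = b₀ ∧ (φ₁ i₁).2 = false := by by_contra h; exact hi₁ (if_neg h)
    have hi₁0 : i₁ ≠ 0 := by
      rintro rfl
      rw [hφ₁0] at hP₁
      rw [hP₁.2] at hc₀
      exact Bool.false_ne_true hc₀
    let i1 : Fin (2 * (m + 1)) := (0 : Fin (2 * m + 1)).succ
    have hi1 : i1 ≠ 0 := Fin.succ_ne_zero 0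
    let σ₂ : Equiv.Perm (Fin (2 * (m + 1))) := Equiv.swap i1 i₁
    let φ₂ : Fin (2 * (m + 1)) → J × Bool := φ₁ ∘ σ₂
    have hσ₂0 : σ₂ 0 = 0 := Equiv.swap_apply_of_ne_of_ne hi1.symm hi₁0.symm
    have hφ₂0 : φ₂ 0 = φ i₀ := by change φ₁ (σ₂ 0) = _; rw [hσ₂0, hφ₁0]
    have hφ₂1 : φ₂ i1 = φ₁ i₁ := by change φ₁ (σ₂ i1) = _; rw [Equiv.swap_apply_left]
    have hbal₂ : Balanced ℓ φ₂ := fun b ↦ by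
      change cntLC ℓ (φ₁ ∘ σ₂) b true = cntLC ℓ (φ₁ ∘ σ₂) b false
      rw [cntLC_comp_perm φ₁ σ₂, cntLC_comp_perm φ₁ σ₂]; exact hbal₁ b
    -- Step 3: the double tail is balanced
    let τ : Fin (2 * m) → J × Bool := fun k ↦ φ₂ k.succ.succ
    have hτ : Balanced ℓ τ := by
      intro b
      have h := hbal₂ b
      unfold cntLC at h ⊢
      change (∑ k : Fin (2 * m + 1 + 1), if ℓ (φ₂ k).1 = b ∧ (φ₂ k).2 = true then 1 else 0) =
        ∑ k : Fin (2 * m + 1 + 1), if ℓ (φ₂ k).1 = b ∧ (φ₂ k).2 = false then 1 else 0 at h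
      rw [Fin.sum_univ_succ, Fin.sum_univ_succ, Fin.sum_univ_succ (n := 2 * m + 1),
        Fin.sum_univ_succ (n := 2 * m)] at h
      change (if ℓ (φ₂ 0).1 = b ∧ (φ₂ 0).2 = true then 1 else 0) +
          ((if ℓ (φ₂ i1).1 = b ∧ (φ₂ i1).2 = true then 1 else 0) +
            ∑ k : Fin (2 * m), if ℓ (τ k).1 = b ∧ (τ k).2 = true then 1 else 0) =
        (if ℓ (φ₂ 0).1 = b ∧ (φ₂ 0).2 = false then 1 else 0) +
          ((if ℓ (φ₂ i1).1 = b ∧ (φ₂ i1).2 = false then 1 else 0) +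
            ∑ k : Fin (2 * m), if ℓ (τ k).1 = b ∧ (τ k).2 = false then 1 else 0) at h
      rw [hφ₂0, hφ₂1, hc₀, hP₁.1, hP₁.2] at h
      simp only [and_true, and_false, Bool.true_eq_false, Bool.false_eq_true, if_false] at h
      split_ifs at h <;> omega
    have hM : mono ω g (2 * m) τ ∈ divisorClassesSpan B.X B.dim m := ih τ hτ
    -- Step 4: the leading pair is a cross class `x_j ⌣ x̄_{j'}`, `ℓ j = ℓ j' = b₀`
    have h11 : (1 : ℕ) + 1 = 2 := by norm_num
    have hpair : cupProduct h11 (colGen ω g (φ₂ 0)) (colGen ω g (φ₂ i1)) ∈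
        Submodule.span ℂ {b : complexBetti B.X 2 | IsRationalClass b ∧ IsOfHodgeType B.dim B.X 2 1 1 b} := by
      have e0 : φ₂ 0 = ((φ i₀).1, true) := by rw [hφ₂0]; exact Prod.ext rfl hc₀
      have e1 : φ₂ i1 = ((φ₁ i₁).1, false) := by rw [hφ₂1]; exact Prod.ext rfl hP₁.2
      rw [e0, e1]
      exact cross_mem_span_rational_oneOne hE hd hψ hω hω0 hωgen _ _ (hb₀.symm.trans hP₁.1.symm)
    -- Step 5: `z₀ ⌣ (z₁ ⌣ M) = M ⌣ (z₀ ⌣ z₁)` and conclusion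
    have hmem : mono ω g (2 * (m + 1)) φ₂ ∈ divisorClassesSpan B.X B.dim (m + 1) := by
      have e1 : mono ω g (2 * (m + 1)) φ₂ =
          cupProduct (Nat.add_comm 1 (2 * m + 1)) (colGen ω g (φ₂ 0))
            (cupProduct (Nat.add_comm 1 (2 * m)) (colGen ω g (φ₂ i1)) (mono ω g (2 * m) τ)) := by
        change cupPowOne ℂ (Motives.ComplexPoints B.X) (2 * m + 1 + 1) (colGen ω g ∘ φ₂) = _
        rw [cupPowOne_succ, cupPowOne_succ]
        rfl
      rw [e1, ← cupProduct_assoc h11 (Nat.add_comm 1 (2 * m))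
        (show 2 + 2 * m = 2 * m + 1 + 1 by ring) (Nat.add_comm 1 (2 * m + 1)),
        cupProduct_gradedComm_holds ℂ (Motives.ComplexPoints B.X)
          (show 2 + 2 * m = 2 * m + 1 + 1 by ring) (show 2 * m + 2 = 2 * m + 1 + 1 by ring)]
      have hsign : ((-1 : ℂ) ^ (2 * (2 * m))) = 1 := by rw [pow_mul]; norm_num
      rw [hsign, one_smul]
      exact cupProduct_mem_divisorClassesSpan_succ (show 2 * m + 2 = 2 * (m + 1) by ring) hM hpair
    -- Undo the two transpositions.
    have h2 : mono ω g (2 * (m + 1)) φ₁ ∈ divisorClassesSpan B.X B.dim (m + 1) :=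
      (cupPowOne_comp_swap_mem_iff (divisorClassesSpan B.X B.dim (m + 1)) (colGen ω g ∘ φ₁) i1 i₁).1 hmem
    exact (cupPowOne_comp_swap_mem_iff (divisorClassesSpan B.X B.dim (m + 1)) (colGen ω g ∘ φ) 0 i₀).1 h2

omit [Fintype J] [DecidableEq J] [DecidableEq L] in
/-- Monomials of non-injective words may be dropped from a spanning set. [folklore] -/
private theorem span_mono_image_le {n : ℕ} {S S' : Set (Fin n → J × Bool)}
    (h : ∀ φ ∈ S, Function.Injective φ → φ ∈ S') :
    Submodule.span ℂ (mono ω g n '' S) ≤ Submodule.span ℂ (mono ω g n '' S') := by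
  refine Submodule.span_le.2 ?_
  rintro _ ⟨φ, hφ, rfl⟩
  by_cases hi : Function.Injective φ
  · exact Submodule.subset_span ⟨φ, h φ hφ hi, rfl⟩
  · rw [mono_eq_zero_of_not_injective hi]; exact Submodule.zero_mem _

/-! #### Assembly: `Bᵖ ⊆ Dᵖ ⊗ ℂ` for a variety with a slot structure -/

/-- **The engine.** For `B` with slots (`g_j`, `T_j`, `H^{1,0}(B) = span x_j`) over finitely many
elliptic curves `E_l` with complex multiplication `ψ_l² = -d_l`, `d_l · d_{l'}` not a square for
`l ≠ l'`, and `(1,0)`-generators `ω_l` with `ψ_l^* ω_l = μ_l ω_l`: every rational `(p,p)`-class of `B`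
lies in `Dᵖ(B) ⊗ ℂ`. Proof: `c = ∑_κ P_κ c` (key projectors); each `P_κ c` is rational of type `(p,p)`
and lies in the span of the `(p,p)`-monomials of the key `κ`; a balanced key contributes an element
of `Dᵖ ⊗ ℂ`, an unbalanced one contributes `0` (`eq_zero_of_unbalanced`, traces).
[cite: vanGeemen1994HodgeAV, Thm. 4.3] [cite: Gordon1997, §3] [cite: MoonenZarhin1999LowDim, §3 Cor. (3.9)] -/
private theorem hodgeClasses_divisorial_of_slots [Fintype L] {d : L → ℕ} (hE : ∀ b, (E b).dim = 1)
    (hd : ∀ b, 0 < d b) (hψ : ∀ b, ψ b ≫ ψ b = -(d b • 𝟙 (E b)))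
    (hsq : ∀ l l', l ≠ l' → ¬ IsSquare (d l * d l'))
    (hω : ∀ b, IsOfHodgeType (E b).dim (E b).X 1 1 0 (ω b)) (hω0 : ∀ b, ω b ≠ 0)
    (hωgen : ∀ b (u : complexBetti (E b).X 1), IsOfHodgeType (E b).dim (E b).X 1 1 0 u → ∃ c : ℂ, u = c • ω b)
    (hμω : ∀ b, complexBetti.map (ψ b).hom.hom.hom 1 (ω b) = μ b • ω b)
    (hμ2 : ∀ b, μ b ^ 2 = -(d b : ℂ))
    (hTg : ∀ j, T j ≫ g j = g j ≫ ψ (ℓ j)) (hTg' : ∀ j i, i ≠ j → T j ≫ g i = g i)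
    (hspan : ∀ u : complexBetti B.X 1, IsOfHodgeType B.dim B.X 1 1 0 u →
      u ∈ Submodule.span ℂ (Set.range (slotGen ω g)))
    (p : ℕ) (c : complexBetti B.X (2 * p)) (hc : IsRationalClass c)
    (hpp : IsOfHodgeType B.dim B.X (2 * p) p p c) : c ∈ divisorClassesSpan B.X B.dim p := by
  classical
  have hBs : IsSmoothProjective B.dim B.X := Motives.AbelianVariety.isSmoothProjective_holds
  have hμc : ∀ b, starRingEnd ℂ (μ b) = -μ b := fun b ↦ conj_eq_neg_of_sq_eq_neg_aux (hd b) (hμ2 b)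
  rcases Nat.eq_zero_or_pos p with rfl | hp
  · -- degree 0: every class is a multiple of `1 = cupPowOne 0`
    have hspan0 := (Motives.AbelianVariety.hasExteriorCohomologyH1_complexPoints B).span_range_cupPowOne (2 * 0)
    have hc_top : c ∈ Submodule.span ℂ (Set.range (cupPowOne ℂ (Motives.ComplexPoints B.X) (2 * 0))) := by
      rw [hspan0]; exact Submodule.mem_top
    refine Submodule.span_mono ?_ hc_top
    rintro _ ⟨v, rfl⟩
    exact mem_divisorMonomials_zero.2 (cupPowOne_zero ℂ (Motives.ComplexPoints B.X) v)
  -- `c = ∑_κ P_κ c`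
  rw [← sum_keyOp_apply hμω hd hμ2 hTg hTg' hspan (2 * p) c]
  refine Submodule.sum_mem _ fun κ hκ ↦ ?_
  obtain ⟨φ₀, -, rfl⟩ := Finset.mem_image.1 hκ
  have G := goodOp_keyOp hμω hμc hTg hTg' d (key ℓ φ₀) (2 * p) p
  set v := keyOp T ℓ d (key ℓ φ₀) (2 * p) c with hv
  have hvrat : IsRationalClass v := G.2.1 c hc
  have hvpp : IsOfHodgeType B.dim B.X (2 * p) p p v := G.2.2 c hpp
  -- `v` lies in the span of the (injective) monomials of the key of `φ₀`
  set S₁ : Set (Fin (2 * p) → J × Bool) := {φ | Function.Injective φ ∧ key ℓ φ = key ℓ φ₀} with hS₁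
  have hv1 : v ∈ Submodule.span ℂ (mono ω g (2 * p) '' S₁) := by
    have h0 : c ∈ Submodule.span ℂ (mono ω g (2 * p) '' Set.univ) := by
      rw [Set.image_univ]; exact mem_span_mono hspan _ c
    have hkey : ∀ φ ∈ {φ : Fin (2 * p) → J × Bool | φ ∈ Set.univ ∧ keySymbol μ ℓ d (key ℓ φ₀) φ ≠ 0},
        Function.Injective φ → φ ∈ S₁ := by
      rintro φ ⟨-, hne⟩ hinj
      rw [keySymbol_eq_of_injective hd hμ2 hinj φ₀] at hne
      rw [hS₁, Set.mem_setOf_eq]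
      refine ⟨hinj, ?_⟩
      by_contra hk
      exact hne (if_neg hk)
    exact span_mono_image_le hkey (G.apply_mem_span Set.univ h0)
  -- the type-`(p,p)` projector keeps only the monomials with `# tt = p`
  set S₂ : Set (Fin (2 * p) → J × Bool) :=
    {φ | Function.Injective φ ∧ key ℓ φ = key ℓ φ₀ ∧ cntC φ true = p} with hS₂
  obtain ⟨M⟩ := nonempty_hodgeModel_holds hBs
  have hpq : (p, p) ∈ Finset.HasAntidiagonal.antidiagonal (2 * p) := by
    rw [Finset.HasAntidiagonal.mem_antidiagonal]; ring
  let pq₀ : ↥(Finset.HasAntidiagonal.antidiagonal (2 * p)) := ⟨(p, p), hpq⟩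
  have hvP : v ∈ M.typePiece (2 * p) pq₀ := (M.mem_typePiece_iff pq₀ v).2 (hvpp.mem_hodgePQ hBs M)
  have hproj : ∀ φ : Fin (2 * p) → J × Bool, M.typeProj (2 * p) pq₀ (mono ω g (2 * p) φ) =
      if cntC φ true = p then mono ω g (2 * p) φ else 0 := by
    intro φ
    have ht := isOfHodgeType_mono (g := g) hω (by omega : 0 < 2 * p) φ
    have hsum := cntC_true_add_cntC_false φ
    have hmem : (cntC φ true, cntC φ false) ∈ Finset.HasAntidiagonal.antidiagonal (2 * p) := by
      rw [Finset.HasAntidiagonal.mem_antidiagonal]; exact hsum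
    let pq₁ : ↥(Finset.HasAntidiagonal.antidiagonal (2 * p)) := ⟨_, hmem⟩
    have hP : mono ω g (2 * p) φ ∈ M.typePiece (2 * p) pq₁ :=
      (M.mem_typePiece_iff pq₁ _).2 (ht.mem_hodgePQ hBs M)
    by_cases h : cntC φ true = p
    · have e : pq₁ = pq₀ := Subtype.ext (Prod.ext h (by change cntC φ false = p; omega))
      rw [if_pos h, ← e]
      exact M.typeProj_apply_of_mem hP
    · rw [if_neg h]
      exact M.typeProj_apply_of_mem_ne (fun e ↦ h (congrArg (fun t : ↥(Finset.HasAntidiagonal.antidiagonal (2 * p)) ↦ t.1.1) e)) hP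
  have hv2 : v ∈ Submodule.span ℂ (mono ω g (2 * p) '' S₂) := by
    have hle : Submodule.span ℂ (mono ω g (2 * p) '' S₁) ≤
        (Submodule.span ℂ (mono ω g (2 * p) '' S₂)).comap (M.typeProj (2 * p) pq₀) := by
      refine Submodule.span_le.2 ?_
      rintro _ ⟨φ, hφ, rfl⟩
      rw [SetLike.mem_coe, Submodule.mem_comap, hproj φ]
      by_cases h : cntC φ true = p
      · rw [if_pos h]; exact Submodule.subset_span ⟨φ, ⟨hφ.1, hφ.2, h⟩, rfl⟩
      · rw [if_neg h]; exact Submodule.zero_mem _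
    have h := hle hv1
    rw [Submodule.mem_comap, M.typeProj_apply_of_mem hvP] at h
    exact h
  -- is there a `(p,p)`-word in the key at all?
  by_cases hex : ∃ φ₁ : Fin (2 * p) → J × Bool,
      Function.Injective φ₁ ∧ key ℓ φ₁ = key ℓ φ₀ ∧ cntC φ₁ true = p
  swap
  · have he : mono ω g (2 * p) '' S₂ = ∅ := by
      rw [Set.image_eq_empty, Set.eq_empty_iff_forall_notMem]
      exact fun φ hφ ↦ hex ⟨φ, hφ⟩
    rw [he, Submodule.span_empty, Submodule.mem_bot] at hv2
    rw [hv2]; exact Submodule.zero_mem _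
  obtain ⟨φ₁, hφ₁, hk₁, -⟩ := hex
  by_cases hbal : Balanced ℓ φ₁
  · -- GOOD key: every member is balanced, hence in `Dᵖ ⊗ ℂ`
    refine (Submodule.span_le.2 ?_) hv2
    rintro _ ⟨φ, ⟨hφ, hk, -⟩, rfl⟩
    have hb : Balanced ℓ φ := (balanced_iff_of_key_eq hφ₁ hφ (hk₁.trans hk.symm)).1 hbal
    exact mono_mem_divisorClassesSpan_of_balanced hE hd hψ hω hω0 hωgen p φ hb
  · -- BAD key: no rational `(p,p)`-class (trace argument, `eq_zero_of_unbalanced`)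
    have hv0 : v = 0 :=
      eq_zero_of_unbalanced hμω hμc hTg hTg' hd hμ2 hsq hφ₁ hbal hvrat
        (by rw [hS₂, ← hk₁] at hv2; exact hv2)
    rw [hv0]; exact Submodule.zero_mem _

end Engine

end CMSlots

/-! ### §4 The theorems -/

section Main

variable {L : Type} [Fintype L] [DecidableEq L] {E : L → AbelianVariety ℂ} {ψ : ∀ b, E b ⟶ E b}
  {d : L → ℕ}

/-- **`Bᵖ(B) ⊆ Dᵖ(B) ⊗ ℂ` for a complex abelian variety with a slot structure over finitely many CM
elliptic curves with PAIRWISE DIFFERENT CM fields** (`dim E_l = 1`, `ψ_l ≫ ψ_l = -d_l`, `d_l ≥ 1`,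
`d_l d_{l'}` not a square for `l ≠ l'`; `ω_l` generators of `H^{1,0}(E_l)`): every rational class of
Hodge type `(p,p)` on `B` lies in the complexified divisor ring. [cite: vanGeemen1994HodgeAV, Thm. 4.3]
[cite: MoonenZarhin1999LowDim, §3 Cor. (3.9)] [cite: Gordon1997, §3] -/
theorem hodgeClasses_divisorial_of_cmSlots (hE : ∀ b, (E b).dim = 1) (hd : ∀ b, 0 < d b)
    (hψ : ∀ b, ψ b ≫ ψ b = -(d b • 𝟙 (E b))) (hsq : ∀ l l', l ≠ l' → ¬ IsSquare (d l * d l'))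
    {ω : ∀ b, complexBetti (E b).X 1} (hω : ∀ b, IsOfHodgeType (E b).dim (E b).X 1 1 0 (ω b))
    (hω0 : ∀ b, ω b ≠ 0)
    (hωgen : ∀ b (u : complexBetti (E b).X 1), IsOfHodgeType (E b).dim (E b).X 1 1 0 u → ∃ c : ℂ, u = c • ω b)
    {B : AbelianVariety ℂ} (hB : CMSlots E ψ ω B) (p : ℕ) (c : complexBetti B.X (2 * p))
    (hc : IsRationalClass c) (hpp : IsOfHodgeType B.dim B.X (2 * p) p p c) :
    c ∈ divisorClassesSpan B.X B.dim p := by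
  classical
  obtain ⟨J, _, ℓ, g, T, hTg, hTg', hspan⟩ := hB
  choose μ hμω hμ2 _ using fun b ↦
    EllipticCurve.cm_eigenvalue (ψ b) (hd b) (hψ b) (hω b) (hω0 b) (hωgen b)
  exact CMSlots.hodgeClasses_divisorial_of_slots hE hd hψ hsq hω hω0 hωgen hμω hμ2 hTg hTg' hspan p c hc hpp

/-- **The Hodge classes of such a `B` are algebraic, in every codimension** (`Dᵖ ⊗ ℂ ⊆ Nᵖ H²ᵖ`:
products of divisor classes are algebraic on an abelian variety,
`AbelianVariety.divisorClassesSpan_le_algebraicClasses`, Lefschetz `(1,1)` being the tree's theorem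
`lefschetzOneOne_rational_holds`). [cite: vanGeemen1994HodgeAV, Thm. 4.3 and §2.4] -/
theorem hodgeClasses_algebraic_of_cmSlots (hE : ∀ b, (E b).dim = 1) (hd : ∀ b, 0 < d b)
    (hψ : ∀ b, ψ b ≫ ψ b = -(d b • 𝟙 (E b))) (hsq : ∀ l l', l ≠ l' → ¬ IsSquare (d l * d l'))
    {ω : ∀ b, complexBetti (E b).X 1} (hω : ∀ b, IsOfHodgeType (E b).dim (E b).X 1 1 0 (ω b))
    (hω0 : ∀ b, ω b ≠ 0)
    (hωgen : ∀ b (u : complexBetti (E b).X 1), IsOfHodgeType (E b).dim (E b).X 1 1 0 u → ∃ c : ℂ, u = c • ω b)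
    {B : AbelianVariety ℂ} (hB : CMSlots E ψ ω B) (p : ℕ) (c : complexBetti B.X (2 * p))
    (hc : IsRationalClass c) (hpp : IsOfHodgeType B.dim B.X (2 * p) p p c) :
    c ∈ algebraicClasses B.X p :=
  AbelianVariety.divisorClassesSpan_le_algebraicClasses B
    (fun b hb hb' ↦ lefschetzOneOne_rational_holds
      (Motives.AbelianVariety.isSmoothProjective_holds (A := B)) b hb hb') p
    (hodgeClasses_divisorial_of_cmSlots hE hd hψ hsq hω hω0 hωgen hB p c hc hpp)

/-- **The Hodge conjecture for every complex abelian variety with a slot structure over finitely many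
CM elliptic curves with pairwise different CM fields**, in the summit layer's spelling
`HodgeConjectureFor`. UNCONDITIONAL. [cite: vanGeemen1994HodgeAV, Thm. 4.3]
[cite: MoonenZarhin1999LowDim, §3 Cor. (3.9)] -/
theorem hodgeConjectureFor_of_cmSlots (hE : ∀ b, (E b).dim = 1) (hd : ∀ b, 0 < d b)
    (hψ : ∀ b, ψ b ≫ ψ b = -(d b • 𝟙 (E b))) (hsq : ∀ l l', l ≠ l' → ¬ IsSquare (d l * d l'))
    {ω : ∀ b, complexBetti (E b).X 1} (hω : ∀ b, IsOfHodgeType (E b).dim (E b).X 1 1 0 (ω b))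
    (hω0 : ∀ b, ω b ≠ 0)
    (hωgen : ∀ b (u : complexBetti (E b).X 1), IsOfHodgeType (E b).dim (E b).X 1 1 0 u → ∃ c : ℂ, u = c • ω b)
    {B : AbelianVariety ℂ} (hB : CMSlots E ψ ω B) : HodgeConjectureFor B.dim B.X :=
  ⟨nonempty_hodgeModel_holds (Motives.AbelianVariety.isSmoothProjective_holds (A := B)),
    fun p c hc hpp ↦ hodgeClasses_algebraic_of_cmSlots hE hd hψ hsq hω hω0 hωgen hB p c hc hpp⟩

omit [Fintype L] [DecidableEq L] in
/-- **Generators exist**: each curve `E_l` has a non-zero `(1,0)`-class spanning `H^{1,0}(E_l)`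
(`h^{1,0} = 1` for a curve of genus one), so the slot theorems apply with some `ω`; a statement free of
`ω` for products. [cite: LangeBirkenhake1992, §1.1 Lemma 1.1.17 and Thm. 4.2.1] [cite: VoisinHodgeI2002, §6.1.3 Cor. 6.14] -/
theorem exists_cm_generators (hE : ∀ b, (E b).dim = 1) :
    ∃ ω : ∀ b, complexBetti (E b).X 1, (∀ b, IsOfHodgeType (E b).dim (E b).X 1 1 0 (ω b)) ∧
      (∀ b, ω b ≠ 0) ∧
      ∀ b (u : complexBetti (E b).X 1), IsOfHodgeType (E b).dim (E b).X 1 1 0 u → ∃ c : ℂ, u = c • ω b := by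
  choose ω hω hω0 hgen using fun b ↦ EllipticCurve.exists_hodgeOneZero_generator (hE b)
  exact ⟨ω, hω, hω0, hgen⟩

/-- **Isogeny closure of the slot criterion**: the Hodge conjecture for every complex abelian variety
isogenous to one with a slot structure over the curves (all products of copies of the `E_l` in any
bracketing, `cmSlots_self`, `CMSlots.prod`, `CMSlots.powSucc`). UNCONDITIONAL.
[cite: vanGeemen1994HodgeAV, Lemma 3.7 and Thm. 4.3] -/
theorem hodgeConjectureFor_of_isIsogenous_of_cmSlots (hE : ∀ b, (E b).dim = 1) (hd : ∀ b, 0 < d b)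
    (hψ : ∀ b, ψ b ≫ ψ b = -(d b • 𝟙 (E b))) (hsq : ∀ l l', l ≠ l' → ¬ IsSquare (d l * d l'))
    {ω : ∀ b, complexBetti (E b).X 1} (hω : ∀ b, IsOfHodgeType (E b).dim (E b).X 1 1 0 (ω b))
    (hω0 : ∀ b, ω b ≠ 0)
    (hωgen : ∀ b (u : complexBetti (E b).X 1), IsOfHodgeType (E b).dim (E b).X 1 1 0 u → ∃ c : ℂ, u = c • ω b)
    {A B : AbelianVariety ℂ} (hA : A.IsIsogenous B) (hB : CMSlots E ψ ω B) :
    HodgeConjectureFor A.dim A.X :=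
  HodgeConjectureFor.of_isIsogenous hA (hodgeConjectureFor_of_cmSlots hE hd hψ hsq hω hω0 hωgen hB)

/-! #### Products indexed by a list of labels -/

variable (E) in
/-- The product `A × E_{l₁}^{n₁+1} × E_{l₂}^{n₂+1} × ⋯` attached to an abelian variety `A` and a list
of (label, exponent) pairs, bracketed to the left:
`cmListProd A [(l₁,n₁), (l₂,n₂)] = (A × E_{l₁}^{n₁+1}) × E_{l₂}^{n₂+1}`. Every finite product of
positive powers of the curves is of this form (start from `A = E_l^{n+1}`). [folklore] -/
def cmListProd : AbelianVariety ℂ → List (L × ℕ) → AbelianVariety ℂ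
  | A, [] => A
  | A, b :: w => cmListProd (A.prod ((E b.1).powSucc b.2)) w

omit [Fintype L] [DecidableEq L] in
/-- A list product over a variety with a slot structure carries a slot structure. [folklore] -/
private theorem cmSlots_cmListProd {ω : ∀ b, complexBetti (E b).X 1}
    (hωgen : ∀ b (u : complexBetti (E b).X 1), IsOfHodgeType (E b).dim (E b).X 1 1 0 u → ∃ c : ℂ, u = c • ω b)
    {A : AbelianVariety ℂ} (hA : CMSlots E ψ ω A) (w : List (L × ℕ)) : CMSlots E ψ ω (cmListProd E A w) := by
  induction w generalizing A with
  | nil => exact hA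
  | cons b w ih => exact ih (hA.prod ((cmSlots_self (ψ := ψ) b.1 (hωgen b.1)).powSucc b.2))

/-- **The Hodge conjecture for every product `E_{l₀}^{n₀+1} × ∏ E_{l_i}^{n_i + 1}` of positive powers
of CM elliptic curves with pairwise different CM fields (any list of labels, repetitions allowed) and
for every complex abelian variety isogenous to such a product.** UNCONDITIONAL.
[cite: vanGeemen1994HodgeAV, Lemma 3.7 and Thm. 4.3] [cite: MoonenZarhin1999LowDim, §3 Cor. (3.9)] -/
theorem hodgeConjectureFor_of_isIsogenous_cmListProd (hE : ∀ b, (E b).dim = 1) (hd : ∀ b, 0 < d b)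
    (hψ : ∀ b, ψ b ≫ ψ b = -(d b • 𝟙 (E b))) (hsq : ∀ l l', l ≠ l' → ¬ IsSquare (d l * d l'))
    (a : L × ℕ) (w : List (L × ℕ)) {A : AbelianVariety ℂ}
    (hA : A.IsIsogenous (cmListProd E ((E a.1).powSucc a.2) w)) : HodgeConjectureFor A.dim A.X := by
  obtain ⟨ω, hω, hω0, hgen⟩ := exists_cm_generators hE
  exact hodgeConjectureFor_of_isIsogenous_of_cmSlots hE hd hψ hsq hω hω0 hgen hA
    (cmSlots_cmListProd (ψ := ψ) hgen ((cmSlots_self (ψ := ψ) a.1 (hgen a.1)).powSucc a.2) w)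

/-- **`Bᵖ ⊆ Dᵖ ⊗ ℂ` on every list product** (the rational-class form of `B = D`, van Geemen's
notation). [cite: vanGeemen1994HodgeAV, Thm. 4.3] -/
theorem hodgeClasses_divisorial_cmListProd (hE : ∀ b, (E b).dim = 1) (hd : ∀ b, 0 < d b)
    (hψ : ∀ b, ψ b ≫ ψ b = -(d b • 𝟙 (E b))) (hsq : ∀ l l', l ≠ l' → ¬ IsSquare (d l * d l'))
    (a : L × ℕ) (w : List (L × ℕ)) (p : ℕ)
    (c : complexBetti (cmListProd E ((E a.1).powSucc a.2) w).X (2 * p)) (hc : IsRationalClass c)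
    (hpp : IsOfHodgeType (cmListProd E ((E a.1).powSucc a.2) w).dim
      (cmListProd E ((E a.1).powSucc a.2) w).X (2 * p) p p c) :
    c ∈ divisorClassesSpan (cmListProd E ((E a.1).powSucc a.2) w).X
      (cmListProd E ((E a.1).powSucc a.2) w).dim p := by
  obtain ⟨ω, hω, hω0, hgen⟩ := exists_cm_generators hE
  exact hodgeClasses_divisorial_of_cmSlots hE hd hψ hsq hω hω0 hgen
    (cmSlots_cmListProd (ψ := ψ) hgen ((cmSlots_self (ψ := ψ) a.1 (hgen a.1)).powSucc a.2) w) p c hc hpp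

end Main

/-! ### §5 Two curves: the original API of this file (label type `Bool`), derived -/

section TwoSlots

variable (E : Bool → AbelianVariety ℂ) (ψ : ∀ b, E b ⟶ E b) (ω : ∀ b, complexBetti (E b).X 1)

/-- **Slot structure over two elliptic curves `E tt`, `E ff`** — the case `L = Bool` of `CMSlots`
(kept under its original name; p194131). [cite: Gordon1997, §3] [cite: LangeBirkenhake1992, Thm. 4.2.1] -/
def TwoCMSlots (B : AbelianVariety ℂ) : Prop := CMSlots E ψ ω B

variable {E ψ ω}

/-- The curve `E_b` itself has a (two-curve) slot structure. [folklore] -/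
theorem twoCMSlots_self (b : Bool)
    (hω : ∀ u : complexBetti (E b).X 1, IsOfHodgeType (E b).dim (E b).X 1 1 0 u → ∃ c : ℂ, u = c • ω b) :
    TwoCMSlots E ψ ω (E b) :=
  cmSlots_self (ψ := ψ) b hω

/-- Two-curve slot structures multiply. [cite: LangeBirkenhake1992, Thm. 4.2.1] -/
theorem TwoCMSlots.prod {B₁ B₂ : AbelianVariety ℂ} (h₁ : TwoCMSlots E ψ ω B₁) (h₂ : TwoCMSlots E ψ ω B₂) :
    TwoCMSlots E ψ ω (B₁.prod B₂) :=
  CMSlots.prod h₁ h₂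

/-- Powers: `B^{n+1}` carries a two-curve slot structure if `B` does. [cite: LangeBirkenhake1992, Thm. 4.2.1] -/
theorem TwoCMSlots.powSucc {B : AbelianVariety ℂ} (h : TwoCMSlots E ψ ω B) :
    ∀ n : ℕ, TwoCMSlots E ψ ω (B.powSucc n) :=
  CMSlots.powSucc h

/-- `d tt · d ff` not a square ⟹ the pairwise condition on `Bool`. [folklore] -/
private theorem pairwise_not_isSquare_bool {d : Bool → ℕ} (hsq : ¬ IsSquare (d true * d false)) :
    ∀ l l' : Bool, l ≠ l' → ¬ IsSquare (d l * d l') := by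
  rintro (_ | _) (_ | _) h
  · exact absurd rfl h
  · rwa [mul_comm]
  · exact hsq
  · exact absurd rfl h

end TwoSlots

section TwoMain

variable {E : Bool → AbelianVariety ℂ} {ψ : ∀ b, E b ⟶ E b} {d : Bool → ℕ}

/-- **`Bᵖ(B) ⊆ Dᵖ(B) ⊗ ℂ` for a complex abelian variety with a slot structure over two CM elliptic
curves with different CM fields** (`dim E_b = 1`, `ψ_b ≫ ψ_b = -d_b`, `d_b ≥ 1`, `d_tt d_ff` not a
square; `ω_b` generators of `H^{1,0}(E_b)`): every rational class of Hodge type `(p,p)` on `B` lies in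
the complexified divisor ring. [cite: vanGeemen1994HodgeAV, Thm. 4.3]
[cite: MoonenZarhin1999LowDim, §3 Cor. (3.9)] [cite: Gordon1997, §3] -/
theorem hodgeClasses_divisorial_of_twoCMSlots (hE : ∀ b, (E b).dim = 1) (hd : ∀ b, 0 < d b)
    (hψ : ∀ b, ψ b ≫ ψ b = -(d b • 𝟙 (E b))) (hsq : ¬ IsSquare (d true * d false))
    {ω : ∀ b, complexBetti (E b).X 1} (hω : ∀ b, IsOfHodgeType (E b).dim (E b).X 1 1 0 (ω b))
    (hω0 : ∀ b, ω b ≠ 0)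
    (hωgen : ∀ b (u : complexBetti (E b).X 1), IsOfHodgeType (E b).dim (E b).X 1 1 0 u → ∃ c : ℂ, u = c • ω b)
    {B : AbelianVariety ℂ} (hB : TwoCMSlots E ψ ω B) (p : ℕ) (c : complexBetti B.X (2 * p))
    (hc : IsRationalClass c) (hpp : IsOfHodgeType B.dim B.X (2 * p) p p c) :
    c ∈ divisorClassesSpan B.X B.dim p :=
  hodgeClasses_divisorial_of_cmSlots hE hd hψ (pairwise_not_isSquare_bool hsq) hω hω0 hωgen hB p c hc hpp

/-- **The Hodge classes of such a `B` are algebraic, in every codimension.**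
[cite: vanGeemen1994HodgeAV, Thm. 4.3 and §2.4] -/
theorem hodgeClasses_algebraic_of_twoCMSlots (hE : ∀ b, (E b).dim = 1) (hd : ∀ b, 0 < d b)
    (hψ : ∀ b, ψ b ≫ ψ b = -(d b • 𝟙 (E b))) (hsq : ¬ IsSquare (d true * d false))
    {ω : ∀ b, complexBetti (E b).X 1} (hω : ∀ b, IsOfHodgeType (E b).dim (E b).X 1 1 0 (ω b))
    (hω0 : ∀ b, ω b ≠ 0)
    (hωgen : ∀ b (u : complexBetti (E b).X 1), IsOfHodgeType (E b).dim (E b).X 1 1 0 u → ∃ c : ℂ, u = c • ω b)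
    {B : AbelianVariety ℂ} (hB : TwoCMSlots E ψ ω B) (p : ℕ) (c : complexBetti B.X (2 * p))
    (hc : IsRationalClass c) (hpp : IsOfHodgeType B.dim B.X (2 * p) p p c) :
    c ∈ algebraicClasses B.X p :=
  hodgeClasses_algebraic_of_cmSlots hE hd hψ (pairwise_not_isSquare_bool hsq) hω hω0 hωgen hB p c hc hpp

/-- **The Hodge conjecture for every complex abelian variety with a slot structure over two CM
elliptic curves with different CM fields**, in the summit layer's spelling `HodgeConjectureFor`.
UNCONDITIONAL. [cite: vanGeemen1994HodgeAV, Thm. 4.3] [cite: MoonenZarhin1999LowDim, §3 Cor. (3.9)] -/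
theorem hodgeConjectureFor_of_twoCMSlots (hE : ∀ b, (E b).dim = 1) (hd : ∀ b, 0 < d b)
    (hψ : ∀ b, ψ b ≫ ψ b = -(d b • 𝟙 (E b))) (hsq : ¬ IsSquare (d true * d false))
    {ω : ∀ b, complexBetti (E b).X 1} (hω : ∀ b, IsOfHodgeType (E b).dim (E b).X 1 1 0 (ω b))
    (hω0 : ∀ b, ω b ≠ 0)
    (hωgen : ∀ b (u : complexBetti (E b).X 1), IsOfHodgeType (E b).dim (E b).X 1 1 0 u → ∃ c : ℂ, u = c • ω b)
    {B : AbelianVariety ℂ} (hB : TwoCMSlots E ψ ω B) : HodgeConjectureFor B.dim B.X :=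
  hodgeConjectureFor_of_cmSlots hE hd hψ (pairwise_not_isSquare_bool hsq) hω hω0 hωgen hB

/-- **Generators exist** (two-curve spelling of `exists_cm_generators`). [folklore] -/
theorem exists_generators (hE : ∀ b, (E b).dim = 1) :
    ∃ ω : ∀ b, complexBetti (E b).X 1, (∀ b, IsOfHodgeType (E b).dim (E b).X 1 1 0 (ω b)) ∧
      (∀ b, ω b ≠ 0) ∧
      ∀ b (u : complexBetti (E b).X 1), IsOfHodgeType (E b).dim (E b).X 1 1 0 u → ∃ c : ℂ, u = c • ω b :=
  exists_cm_generators hE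

/-- **The Hodge conjecture for `E_tt^{a+1} × E_ff^{b+1}`** (two CM elliptic curves with different CM
fields), UNCONDITIONAL. [cite: vanGeemen1994HodgeAV, Thm. 4.3] [cite: MoonenZarhin1999LowDim, §3 Cor. (3.9)] -/
theorem hodgeConjectureFor_powSucc_prod_powSucc_of_twoCM (hE : ∀ b, (E b).dim = 1) (hd : ∀ b, 0 < d b)
    (hψ : ∀ b, ψ b ≫ ψ b = -(d b • 𝟙 (E b))) (hsq : ¬ IsSquare (d true * d false)) (a b : ℕ) :
    HodgeConjectureFor (((E true).powSucc a).prod ((E false).powSucc b)).dim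
      (((E true).powSucc a).prod ((E false).powSucc b)).X := by
  obtain ⟨ω, hω, hω0, hgen⟩ := exists_generators hE
  exact hodgeConjectureFor_of_twoCMSlots hE hd hψ hsq hω hω0 hgen
    (((twoCMSlots_self (ψ := ψ) true (hgen true)).powSucc a).prod
      ((twoCMSlots_self (ψ := ψ) false (hgen false)).powSucc b))

/-- **`Bᵖ ⊆ Dᵖ ⊗ ℂ` on `E_tt^{a+1} × E_ff^{b+1}`** (the rational-class form of `B = D`, van Geemen's
notation). [cite: vanGeemen1994HodgeAV, Thm. 4.3] -/
theorem hodgeClasses_divisorial_powSucc_prod_powSucc_of_twoCM (hE : ∀ b, (E b).dim = 1)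
    (hd : ∀ b, 0 < d b) (hψ : ∀ b, ψ b ≫ ψ b = -(d b • 𝟙 (E b))) (hsq : ¬ IsSquare (d true * d false))
    (a b p : ℕ) (c : complexBetti (((E true).powSucc a).prod ((E false).powSucc b)).X (2 * p))
    (hc : IsRationalClass c)
    (hpp : IsOfHodgeType (((E true).powSucc a).prod ((E false).powSucc b)).dim
      (((E true).powSucc a).prod ((E false).powSucc b)).X (2 * p) p p c) :
    c ∈ divisorClassesSpan (((E true).powSucc a).prod ((E false).powSucc b)).X
      (((E true).powSucc a).prod ((E false).powSucc b)).dim p := by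
  obtain ⟨ω, hω, hω0, hgen⟩ := exists_generators hE
  exact hodgeClasses_divisorial_of_twoCMSlots hE hd hψ hsq hω hω0 hgen
    (((twoCMSlots_self (ψ := ψ) true (hgen true)).powSucc a).prod
      ((twoCMSlots_self (ψ := ψ) false (hgen false)).powSucc b)) p c hc hpp

/-- **The Hodge conjecture for every complex abelian variety ISOGENOUS to `E_tt^{a+1} × E_ff^{b+1}`**
(van Geemen's Lemma 3.7, the tree's `HodgeConjectureFor.of_isIsogenous`), UNCONDITIONAL.
[cite: vanGeemen1994HodgeAV, Lemma 3.7 and Thm. 4.3] -/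
theorem hodgeConjectureFor_of_isIsogenous_powSucc_prod_powSucc_of_twoCM (hE : ∀ b, (E b).dim = 1)
    (hd : ∀ b, 0 < d b) (hψ : ∀ b, ψ b ≫ ψ b = -(d b • 𝟙 (E b))) (hsq : ¬ IsSquare (d true * d false))
    (a b : ℕ) {A : AbelianVariety ℂ} (hA : A.IsIsogenous (((E true).powSucc a).prod ((E false).powSucc b))) :
    HodgeConjectureFor A.dim A.X :=
  HodgeConjectureFor.of_isIsogenous hA (hodgeConjectureFor_powSucc_prod_powSucc_of_twoCM hE hd hψ hsq a b)

/-- **Isogeny closure of the two-curve slot criterion.** [cite: vanGeemen1994HodgeAV, Lemma 3.7 and Thm. 4.3] -/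
theorem hodgeConjectureFor_of_isIsogenous_of_twoCMSlots (hE : ∀ b, (E b).dim = 1) (hd : ∀ b, 0 < d b)
    (hψ : ∀ b, ψ b ≫ ψ b = -(d b • 𝟙 (E b))) (hsq : ¬ IsSquare (d true * d false))
    {ω : ∀ b, complexBetti (E b).X 1} (hω : ∀ b, IsOfHodgeType (E b).dim (E b).X 1 1 0 (ω b))
    (hω0 : ∀ b, ω b ≠ 0)
    (hωgen : ∀ b (u : complexBetti (E b).X 1), IsOfHodgeType (E b).dim (E b).X 1 1 0 u → ∃ c : ℂ, u = c • ω b)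
    {A B : AbelianVariety ℂ} (hA : A.IsIsogenous B) (hB : TwoCMSlots E ψ ω B) :
    HodgeConjectureFor A.dim A.X :=
  HodgeConjectureFor.of_isIsogenous hA (hodgeConjectureFor_of_twoCMSlots hE hd hψ hsq hω hω0 hωgen hB)

/-- Forward contract: the algebraicity statements of this file are CASES of the Hodge conjecture for
smooth projective varieties (its instance on `B`); the divisor-generation statement itself is Hodge
theory and is proved above, not assumed. [cite: Deligne2000, §1] -/
theorem hodgeClasses_algebraic_of_twoCMSlots_of_hodgeConjectureFor
    (h : ∀ ⦃n : ℕ⦄ ⦃Y : Motives.SchemeOver ℂ⦄, Motives.IsSmoothProjective n Y → HodgeConjectureFor n Y)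
    {B : AbelianVariety ℂ} (p : ℕ) (c : complexBetti B.X (2 * p)) (hc : IsRationalClass c)
    (hpp : IsOfHodgeType B.dim B.X (2 * p) p p c) : c ∈ algebraicClasses B.X p :=
  (h (Motives.AbelianVariety.isSmoothProjective_holds (A := B))).2 p c hc hpp

end TwoMain

/-! ### §6 Two named curves `E₁`, `E₂` -/

section TwoCurves

/-- **The Hodge conjecture for `E₁^{a+1} × E₂^{b+1}` and its isogeny class**, for complex elliptic
curves `E₁`, `E₂` with complex multiplications `ψ₁² = -d₁`, `ψ₂² = -d₂`, `d₁ d₂` not a square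
(different CM fields). UNCONDITIONAL. [cite: vanGeemen1994HodgeAV, Lemma 3.7 and Thm. 4.3]
[cite: MoonenZarhin1999LowDim, §3 Cor. (3.9)] -/
theorem hodgeConjectureFor_of_isIsogenous_twoCMCurves {E₁ E₂ : AbelianVariety ℂ} (hE₁ : E₁.dim = 1)
    (hE₂ : E₂.dim = 1) {ψ₁ : E₁ ⟶ E₁} {ψ₂ : E₂ ⟶ E₂} {d₁ d₂ : ℕ} (hd₁ : 0 < d₁) (hd₂ : 0 < d₂)
    (hψ₁ : ψ₁ ≫ ψ₁ = -(d₁ • 𝟙 E₁)) (hψ₂ : ψ₂ ≫ ψ₂ = -(d₂ • 𝟙 E₂)) (hsq : ¬ IsSquare (d₁ * d₂))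
    (a b : ℕ) {A : AbelianVariety ℂ} (hA : A.IsIsogenous ((E₁.powSucc a).prod (E₂.powSucc b))) :
    HodgeConjectureFor A.dim A.X := by
  let E : Bool → AbelianVariety ℂ := fun t ↦ bif t then E₁ else E₂
  let ψ : ∀ t, E t ⟶ E t := fun t ↦ match t with
    | true => ψ₁
    | false => ψ₂
  let d : Bool → ℕ := fun t ↦ bif t then d₁ else d₂
  have hE : ∀ t, (E t).dim = 1 := by rintro (_ | _) <;> assumption
  have hd : ∀ t, 0 < d t := by rintro (_ | _) <;> assumption
  have hψ : ∀ t, ψ t ≫ ψ t = -(d t • 𝟙 (E t)) := by rintro (_ | _) <;> assumption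
  exact hodgeConjectureFor_of_isIsogenous_powSucc_prod_powSucc_of_twoCM (E := E) (ψ := ψ) (d := d)
    hE hd hψ hsq a b hA

/-- **The Hodge conjecture for `E₁^{a+1} × E₂^{b+1}` itself.** [cite: vanGeemen1994HodgeAV, Thm. 4.3] -/
theorem hodgeConjectureFor_twoCMCurves_powSucc_prod_powSucc {E₁ E₂ : AbelianVariety ℂ} (hE₁ : E₁.dim = 1)
    (hE₂ : E₂.dim = 1) {ψ₁ : E₁ ⟶ E₁} {ψ₂ : E₂ ⟶ E₂} {d₁ d₂ : ℕ} (hd₁ : 0 < d₁) (hd₂ : 0 < d₂)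
    (hψ₁ : ψ₁ ≫ ψ₁ = -(d₁ • 𝟙 E₁)) (hψ₂ : ψ₂ ≫ ψ₂ = -(d₂ • 𝟙 E₂)) (hsq : ¬ IsSquare (d₁ * d₂))
    (a b : ℕ) :
    HodgeConjectureFor ((E₁.powSucc a).prod (E₂.powSucc b)).dim ((E₁.powSucc a).prod (E₂.powSucc b)).X :=
  hodgeConjectureFor_of_isIsogenous_twoCMCurves hE₁ hE₂ hd₁ hd₂ hψ₁ hψ₂ hsq a b
    (Motives.AbelianVariety.IsIsogenous.refl _)

end TwoCurves

/-! ### §7 Three named curves `E₁`, `E₂`, `E₃` -/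

section ThreeCurves

/-- **The Hodge conjecture for `E₁^{a+1} × E₂^{b+1} × E₃^{c+1}` and its isogeny class**, for complex
elliptic curves with complex multiplications `ψᵢ² = -dᵢ` and `d₁d₂`, `d₁d₃`, `d₂d₃` non-squares
(three pairwise different CM fields). UNCONDITIONAL. [cite: vanGeemen1994HodgeAV, Lemma 3.7 and Thm. 4.3]
[cite: MoonenZarhin1999LowDim, §3 Cor. (3.9)] -/
theorem hodgeConjectureFor_of_isIsogenous_threeCMCurves {E₁ E₂ E₃ : AbelianVariety ℂ}
    (hE₁ : E₁.dim = 1) (hE₂ : E₂.dim = 1) (hE₃ : E₃.dim = 1)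
    {ψ₁ : E₁ ⟶ E₁} {ψ₂ : E₂ ⟶ E₂} {ψ₃ : E₃ ⟶ E₃} {d₁ d₂ d₃ : ℕ}
    (hd₁ : 0 < d₁) (hd₂ : 0 < d₂) (hd₃ : 0 < d₃)
    (hψ₁ : ψ₁ ≫ ψ₁ = -(d₁ • 𝟙 E₁)) (hψ₂ : ψ₂ ≫ ψ₂ = -(d₂ • 𝟙 E₂)) (hψ₃ : ψ₃ ≫ ψ₃ = -(d₃ • 𝟙 E₃))
    (h₁₂ : ¬ IsSquare (d₁ * d₂)) (h₁₃ : ¬ IsSquare (d₁ * d₃)) (h₂₃ : ¬ IsSquare (d₂ * d₃))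
    (a b c : ℕ) {A : AbelianVariety ℂ}
    (hA : A.IsIsogenous (((E₁.powSucc a).prod (E₂.powSucc b)).prod (E₃.powSucc c))) :
    HodgeConjectureFor A.dim A.X := by
  classical
  let E : Fin 3 → AbelianVariety ℂ := ![E₁, E₂, E₃]
  let ψ : ∀ t, E t ⟶ E t := fun t ↦
    match t with
    | ⟨0, _⟩ => ψ₁
    | ⟨1, _⟩ => ψ₂
    | ⟨2, _⟩ => ψ₃
  let d : Fin 3 → ℕ := ![d₁, d₂, d₃]
  have hE : ∀ t, (E t).dim = 1 := by
    intro t; fin_cases t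
    · exact hE₁
    · exact hE₂
    · exact hE₃
  have hd : ∀ t, 0 < d t := by
    intro t; fin_cases t
    · exact hd₁
    · exact hd₂
    · exact hd₃
  have hψ : ∀ t, ψ t ≫ ψ t = -(d t • 𝟙 (E t)) := by
    intro t; fin_cases t
    · exact hψ₁
    · exact hψ₂
    · exact hψ₃
  have hsq : ∀ l l', l ≠ l' → ¬ IsSquare (d l * d l') := by
    intro l l' hll'
    fin_cases l <;> fin_cases l'
    · exact absurd rfl hll'
    · exact h₁₂
    · exact h₁₃
    · simpa [d, mul_comm] using h₁₂
    · exact absurd rfl hll'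
    · exact h₂₃
    · simpa [d, mul_comm] using h₁₃
    · simpa [d, mul_comm] using h₂₃
    · exact absurd rfl hll'
  obtain ⟨ω, hω, hω0, hgen⟩ := exists_cm_generators hE
  exact hodgeConjectureFor_of_isIsogenous_of_cmSlots hE hd hψ hsq hω hω0 hgen hA
    ((((cmSlots_self (ψ := ψ) (0 : Fin 3) (hgen 0)).powSucc a).prod
      ((cmSlots_self (ψ := ψ) (1 : Fin 3) (hgen 1)).powSucc b)).prod
      ((cmSlots_self (ψ := ψ) (2 : Fin 3) (hgen 2)).powSucc c))

end ThreeCurves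

end HodgeTheory

end Literature.AlgebraicGeometry.HodgeTheory

end
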